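import Literature.AlgebraicGeometry.Shioda1982.StandardQuadrupleTwoThreePower
import Literature.AlgebraicGeometry.Shioda1982.HodgeQuadruplesTwoPowThree
import Literature.AlgebraicGeometry.Shioda1982.HodgeQuadruplesTwiceThreePow
import Literature.AlgebraicGeometry.Shioda1982.HodgeQuadruplesTenPrime
import Literature.AlgebraicGeometry.Shioda1982.StandardQuadruplePrimePower
import Literature.AlgebraicGeometry.Shioda1982.ExceptionalQuadruplesNoneUpTo630
import HarnessLib

/-!
# Standard quadruples at the levels `2ᵃ3ᵇ`: the edge families `3·2ᵃ`, `2·3ᵇ`, and the assembly (`Δ(2ᵃ3ᵇ) = 0`, Theorem C)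

Topic `Literature/AlgebraicGeometry/Shioda1982`. THEOREMS only (no definition of record, no named fact, no `sorry`). Fourth
and last file of the series on [Aoki1983, Thm. C] = [AokiShioda1983, Thm. (𝔅²ₘ) (ii)] = [Shioda1982PicardFermat, Prop. 4 (Q′)]
at the levels `2ᵃ3ᵇ`, after `HodgeQuadruplesTwoThreePower` (I), `…Step` (II), `StandardQuadrupleTwoThreePower` (III: no mixed
quadruple, the induction for `a, b ≥ 2` given the edges, `T(L) = StdOrSmall L` = "every pair-free Hodge `4`-multiset over
`ℤ/L` is `α_x`, `β_x`, `γ_x` or a lift from a level `≤ 72`"), and the Koblitz–Ogus files of the two edges,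
`HodgeQuadruplesTwoPowThree` (levels `3·2ᵃ`: the third relation, twin-or-`γ`) and `HodgeQuadruplesTwiceThreePow` (levels
`2·3ᵇ`: the `Λ`-relation, the shape of a quadruple with a unit member, decided by the kernel). (The docstrings of the earlier
files refer to this material as parts VI `StandardQuadrupleTwoPowThree` and VIII of the working series; merged here.)

PART A — THE EDGE `b = 1` (`m = 3·2ᵃ = 6n`, `n = 2ⁱ`): **`stdOrSmall_twoPowThree : T(3·2ᵃ)` for every `a ≥ 2`** (the
hypothesis `H₂` of `thmB2m_standard_twoThreePower`), by induction on `a` from `T(96)` (no row `96` in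
[MeyerNeutsch1981Fermatquadrupel, Tabelle 1], kernel census `ExceptionalQuadruplesCompleteLeOneHundredEighty`) and `T(L)`,
`L ≤ 72` (void), the step `T(3·2ᵃ⁻¹) ⟹ T(3·2ᵃ)` (`a ≥ 6`, `i ≥ 5`) being:

* **`shape_of_unit_mem_twoPowThree`** / `isStdMultiset_of_unit_mem_twoPowThree`**: a pair-free Hodge quadruple with a unit member `y` is `α_y`, `β_y` or `γ_y` —
  twin or `γ` (part V, `twin_or_gamma_twoPowThree`), the shape `{y, y + 3n, z, w}` of a twin (`shape_of_twin_twoPowThree`),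
  and the twin transfer to level `3n` (part II, `twin_transfer`, branch `4 ∣ N`): its alternatives (iii)–(v) contradict
  `y` odd and prime to `3` (a coset `{2y, z, w} = x′ + (m/3)ℤ` with `2y + z + w = −3n` forces `n ∣ 2⟨y⟩`).
* **`isStdMultiset_of_forall_three_dvd_twoPowThree`**: a pair-free Hodge quadruple all of whose members are divisible by `3`,
  one of them odd, is `s = 3·s′` with `s′` a pair-free Hodge quadruple of level `2ᵃ` with an odd member
  (`isHodgeMultiset_map_liftBy_iff`, [Shioda1982PicardFermat, §2: `𝔍ₘ(d) ≅ 𝔍_{m/d}(1)`]), hence primitive and — there being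
  no exceptional quadruple at a level `2ᵏ` (`not_isExceptionalQuadruple_two_pow`, [Shioda1982PicardFermat, Thm. 6 (c)]) —
  standard: `s′ = α_{x′}` or `β_{x′}`, so `s = α_{3x′}` or `β_{3x′}`.
* **`no_mixed_twoPowThree`**: a pair-free Hodge quadruple without unit member, with an odd member and a member prime to `3`
  (`{u₁, u₂, v₁, v₂}`, `uᵢ` odd multiples of `3`, `vᵢ` even prime to `3`, `mixed_shape` of `StandardQuadrupleTwoThreePower`) does not exist: the third
  relation of part V at `u₁` (its unit partners carry no charge) gives `d(u₁) = 0`, i.e. `u₂ = u₁ + 3n`, and the twin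
  transfer at `y = u₁` leaves only alternatives that put a multiple of `3` among the `vᵢ`, make `u₁` even, or `3 ∣ vᵢ`.
* all members even: part II `std_or_small_of_all_even` (level `3n`).


Then **`not_isExceptionalQuadruple_twoPowThree`**: `Δ(3·2ᵃ) = 0` for `a ≥ 6`, unconditionally (a primitive quadruple has a
unit member, and the parameter of its standard shape is that unit).

PART B — THE EDGE `a = 1` (`m = 2·3ᵇ = 6n`, `n = 3ᵏ`) AND THE ASSEMBLY:

* `std_or_small_twiceThreePow` — the step `T(2·3ᵇ⁻¹) ⟹ T(2·3ᵇ)` (`b ≥ 4`): a pair-free Hodge `4`-multiset `s` over `ℤ/2·3ᵇ`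
  is standard or a lift from a level `≤ 72`. Cases: all members divisible by `3` — division by `3` (part II,
  `std_or_small_of_all_three`, `T(2·3ᵇ⁻¹)`); a unit member — `shape_of_unit_twiceThreePow` (part VII: `γ_y, α_y, β_y, β_x`
  with a UNIT parameter, `isStandardQuadruple_of_unit_mem_twiceThreePow`); a member prime to `3` but no unit member — every
  member is even (`even_of_noUnit_twiceThreePow`, part VII), `s = 2·s′` with `s′` a primitive pair-free Hodge quadruple of the
  odd level `3ᵇ`, standard by [Shioda1982PicardFermat, Thm. 6 (b)] (`not_isExceptionalQuadruple_three_pow`): `s′ = γ_{x′}`,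
  `s = γ_{2x′}` (`isStdMultiset_of_forall_even_twiceThreePow`).
* `stdOrSmall_twiceThreePow` — **`T(2·3ᵇ)` for all `b ≥ 2`** (`H₁`); `stdOrSmall_twoThree` — `T(2ᵃ3ᵇ)` for all `a, b ≥ 1`.
* `not_isExceptionalQuadruple_twiceThreePow`, **`not_isExceptionalQuadruple_twoThree`** — `Δ(m) = 0` for EVERY
  `m = 2ᵃ3ᵇ > 72` (`a, b ≥ 0`): no exceptional Hodge quadruple —, **`thmB2m_standard_twoThree`** — the letter of
  [AokiShioda1983, Thm. (𝔅²ₘ) (ii)] (the body of the named fact `HodgeTheory.AokiShioda1983_thmB2m_standard`) at every level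
  `m = 2ᵃ3ᵇ > 72`, unconditionally —, and **`AokiShioda1983_thmB2m_standard_of_fiveSeven`**: the named fact reduces to the
  letter at the levels `2ᵃ3ᵇ·5`, `2ᵃ3ᵇ·7`, `2ᵃ3ᵇ·35` above `630` (sharpening `AokiShioda1983_thmB2m_standard_of_towers`).


Cross-checks outside Lean (cell `pub-hfermat`, `g39-session/towers/edge/`, brute force over all Hodge `4`-multisets): at
`m = 96, 192` the `180, 308` indecomposable quadruples are `α/β/γ` (`118, 246`, primitive or not) or the `62` lifts of the
exceptional quadruples of levels `12, 24, 48`; unit members are twinned with even partners (`64, 128` cases) or sit in a `γ`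
(`32, 64`); no unit-free indecomposable is mixed.


HONEST FRAMING (cell `pub-hfermat`): explicit algebraic cycles for specific Hodge classes on Fermat/Delsarte varieties; residual
open instances listed; no claim on general Hodge. (Surface classes are algebraic by Lefschetz (1,1); this file classifies the
indecomposable Hodge classes = lines on Fermat surfaces of degree `2ᵃ3ᵇ` in Shioda's combinatorial model; no cycle is
constructed here. Residual for the named fact `AokiShioda1983_thmB2m_standard`: the levels `2ᵃ3ᵇ5ᶜ7ᵈ > 630` with
`(c, d) ∈ {(1,0), (0,1), (1,1)}`, listed, not claimed.)

## References
* [Aoki1983] N. Aoki, *On some arithmetic problems related to the Hodge cycles on the Fermat varieties*, Math. Ann. 266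
  (1983) 23–54 — Thm. C p. 47, Prop. 2.2, Thm. D.
* [AokiShioda1983] N. Aoki, T. Shioda, *Generators of the Néron–Severi group of a Fermat surface*, Progr. Math. 35 (1983)
  1–12 — §2 Thm. (𝔅²ₘ) (ii) a), b), c), p. 3.
* [Shioda1982PicardFermat] T. Shioda, *On the Picard number of a Fermat surface*, J. Fac. Sci. Univ. Tokyo IA 28 (1982)
  725–734 — Lemma 1 p. 728, Prop. 4 (Q′) p. 729, Thm. 6 (b), (c) p. 731, table p. 727, §2 p. 726.
* [MeyerNeutsch1981Fermatquadrupel] W. Meyer, W. Neutsch, *Fermatquadrupel*, Math. Ann. 256 (1981) 51–62 — (13)–(15) p. 53,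
  Tabelle 1 p. 54.
-/

namespace Literature.AlgebraicGeometry.Shioda1982

open Finset Multiset
open Literature.AlgebraicGeometry.HodgeTheory Literature.AlgebraicGeometry.HodgeTheory.FermatCharacter

section TwoPowThreeStd

variable {m n i : ℕ} [NeZero m]

/-- `𝔥 = 3n = m/2` as a residue modulo `m = 6n`. -/
local notation "𝔥" => (((3 * n : ℕ)) : ZMod m)
/-- `𝔯 = 2n = m/3` as a residue modulo `m = 6n`. -/
local notation "𝔯" => (((2 * n : ℕ)) : ZMod m)
/-- `𝔫 = n = m/6` as a residue modulo `m = 6n`. -/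
local notation "𝔫" => (((n : ℕ)) : ZMod m)
/-- `d(w) = o(w) − o(w + 3n)`, `o(w) = #_w s − #_{−w} s`. -/
local notation "𝔡[" s ", " w "]" =>
  (((Multiset.count w s : ℤ) - Multiset.count (-w) s) - ((Multiset.count (w + 𝔥) s : ℤ) - Multiset.count (-(w + 𝔥)) s))

/-! ### Elementary facts at the level `m = 6n = 3·2ⁱ⁺¹` -/

omit [NeZero m] in
/-- `0 < n`. [folklore] -/
private theorem n_pos₆ (hn : n = 2 ^ i) : 0 < n := by
  rw [hn]; positivity

omit [NeZero m] in
/-- `2 ∣ n` when `i ≥ 1`. [folklore] -/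
private theorem two_dvd_n₆ (hn : n = 2 ^ i) (hi : 1 ≤ i) : 2 ∣ n := by
  obtain ⟨i', rfl⟩ := Nat.exists_eq_add_of_le' hi
  exact ⟨2 ^ i', by rw [hn]; ring⟩

omit [NeZero m] in
/-- `4 ∣ n` when `i ≥ 2`. [folklore] -/
private theorem four_dvd_n₆ (hn : n = 2 ^ i) (hi : 2 ≤ i) : 4 ∣ n := by
  obtain ⟨i', rfl⟩ := Nat.exists_eq_add_of_le' hi
  exact ⟨2 ^ i', by rw [hn]; ring⟩

omit [NeZero m] in
/-- `3 ∤ n`. [folklore] -/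
private theorem not_three_dvd_n₆ (hn : n = 2 ^ i) : ¬ 3 ∣ n := by
  rw [hn]
  intro h
  have := (Nat.Prime.dvd_of_dvd_pow Nat.prime_three h)
  omega

omit [NeZero m] in
/-- `3n = 3·n`, `2n = 2·n` as residues. [folklore] -/
private theorem h_eq_three_mul₆ : (𝔥 : ZMod m) = 3 * 𝔫 ∧ (𝔯 : ZMod m) = 2 * 𝔫 := by
  constructor <;> push_cast <;> ring

omit [NeZero m] in
/-- `6·n = 0` in `ℤ/6n`. [folklore] -/
private theorem six_mul_n₆ (hm : m = 6 * n) : (6 : ZMod m) * 𝔫 = 0 := by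
  have e : (6 : ZMod m) * ((n : ℕ) : ZMod m) = ((m : ℕ) : ZMod m) := by rw [hm]; push_cast; ring
  rw [e, ZMod.natCast_self]

omit [NeZero m] in
/-- `⟨3n⟩ = 3n`. [folklore] -/
private theorem val_h₆ (hm : m = 6 * n) (hn0 : 0 < n) : (𝔥 : ZMod m).val = 3 * n := by
  rw [ZMod.val_natCast, Nat.mod_eq_of_lt (by omega)]

omit [NeZero m] in
/-- `⟨2n⟩ = 2n`. [folklore] -/
private theorem val_r₆ (hm : m = 6 * n) (hn0 : 0 < n) : (𝔯 : ZMod m).val = 2 * n := by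
  rw [ZMod.val_natCast, Nat.mod_eq_of_lt (by omega)]

/-- Adding a multiple of `M` does not change the residue mod `M` (`M ∣ m`). [folklore] -/
private theorem mod_add_of_dvd₆ {M : ℕ} (hM : M ∣ m) (x : ZMod m) {c : ZMod m} (hc : M ∣ c.val) :
    (x + c).val % M = x.val % M := by
  obtain ⟨t, ht⟩ := hc
  rw [ZMod.val_add, Nat.mod_mod_of_dvd _ hM, ht, Nat.add_mul_mod_self_left]

/-- `p ∣ ⟨x⟩` iff `x` reduces to `0` modulo `p` (`p ∣ m`). [folklore] -/
private theorem dvd_val_iff_cast₆ {p : ℕ} (hp : p ∣ m) (x : ZMod m) : p ∣ x.val ↔ ZMod.castHom hp (ZMod p) x = 0 := by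
  rw [ZMod.castHom_apply, ZMod.cast_eq_val, ZMod.natCast_eq_zero_iff]

/-- A divisor `p` of `m` divides `⟨−x⟩` iff it divides `⟨x⟩`. [folklore] -/
private theorem dvd_val_neg_iff₆ {p : ℕ} (hp : p ∣ m) (x : ZMod m) : p ∣ (-x).val ↔ p ∣ x.val := by
  rw [dvd_val_iff_cast₆ hp, dvd_val_iff_cast₆ hp, map_neg, neg_eq_zero]

/-- A divisor `p` of `m` dividing `⟨c⟩` divides `⟨x + c⟩` iff it divides `⟨x⟩`. [folklore] -/
private theorem dvd_val_add_iff₆ {p : ℕ} (hp : p ∣ m) (x : ZMod m) {c : ZMod m} (hc : p ∣ c.val) :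
    p ∣ (x + c).val ↔ p ∣ x.val := by
  rw [Nat.dvd_iff_mod_eq_zero, Nat.dvd_iff_mod_eq_zero, mod_add_of_dvd₆ hp x hc]

omit [NeZero m] in
/-- `2 ∣ m`. [folklore] -/
private theorem two_dvd_m₆ (hm : m = 6 * n) : 2 ∣ m := ⟨3 * n, by rw [hm]; ring⟩

omit [NeZero m] in
/-- `3 ∣ m`. [folklore] -/
private theorem three_dvd_m₆ (hm : m = 6 * n) : 3 ∣ m := ⟨2 * n, by rw [hm]; ring⟩

/-- The points `−y, y + 3n, −(y + 3n)` attached to an odd `y` are odd (`2 ∣ n`). [folklore] -/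
private theorem odd_points₆ (hm : m = 6 * n) (hn0 : 0 < n) (h2 : 2 ∣ n) {y : ZMod m} (hy : ¬ 2 ∣ y.val) :
    ¬ 2 ∣ (-y).val ∧ ¬ 2 ∣ (y + 𝔥).val ∧ ¬ 2 ∣ (-(y + 𝔥)).val := by
  have h2h : 2 ∣ (𝔥 : ZMod m).val := by rw [val_h₆ hm hn0]; exact Dvd.dvd.mul_left h2 3
  have a2 : ¬ 2 ∣ (y + 𝔥).val := by rwa [dvd_val_add_iff₆ (two_dvd_m₆ hm) y h2h]
  exact ⟨by rwa [dvd_val_neg_iff₆ (two_dvd_m₆ hm)], a2, by rwa [dvd_val_neg_iff₆ (two_dvd_m₆ hm)]⟩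

/-- The points `−y, y + 3n, −(y + 3n)` attached to a `y` prime to `3` are prime to `3`. [folklore] -/
private theorem prime_three_points₆ (hm : m = 6 * n) (hn0 : 0 < n) {y : ZMod m} (hy3 : ¬ 3 ∣ y.val) :
    ¬ 3 ∣ (-y).val ∧ ¬ 3 ∣ (y + 𝔥).val ∧ ¬ 3 ∣ (-(y + 𝔥)).val := by
  have h3h : 3 ∣ (𝔥 : ZMod m).val := by rw [val_h₆ hm hn0]; exact Dvd.intro n rfl
  have a3 : ¬ 3 ∣ (y + 𝔥).val := by rwa [dvd_val_add_iff₆ (three_dvd_m₆ hm) y h3h]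
  exact ⟨by rwa [dvd_val_neg_iff₆ (three_dvd_m₆ hm)], a3, by rwa [dvd_val_neg_iff₆ (three_dvd_m₆ hm)]⟩

/-- **`3z = 3t ⟺ z ≡ t (mod 2n)`** in `ℤ/6n`. [folklore] -/
private theorem three_mul_eq_iff₆ (hm : m = 6 * n) (z t : ZMod m) :
    (3 : ZMod m) * z = 3 * t ↔ z.val % (2 * n) = t.val % (2 * n) := by
  have h2n : 2 * n ∣ m := ⟨3, by rw [hm]; ring⟩
  rw [← ZMod.natCast_eq_natCast_iff', ← ZMod.cast_eq_val, ← ZMod.cast_eq_val, ← ZMod.castHom_apply (h := h2n),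
    ← ZMod.castHom_apply (h := h2n), ← sub_eq_zero, ← mul_sub, ← sub_eq_zero (a := ZMod.castHom h2n _ z), ← map_sub]
  set w := z - t
  rw [show (3 : ZMod m) * w = (((3 * w.val : ℕ)) : ZMod m) by push_cast; rw [ZMod.natCast_zmod_val],
    ZMod.natCast_eq_zero_iff, ZMod.castHom_apply, ZMod.cast_eq_val, ZMod.natCast_eq_zero_iff]
  have hm' : 3 * (2 * n) ∣ m := ⟨1, by rw [hm]; ring⟩
  have hm'' : m ∣ 3 * (2 * n) := ⟨1, by rw [hm]; ring⟩
  constructor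
  · intro h
    exact (Nat.mul_dvd_mul_iff_left three_pos).mp (dvd_trans hm' h)
  · intro h
    exact dvd_trans hm'' (Nat.mul_dvd_mul_left 3 h)

/-- `w ≠ −w` for an odd `w` (`4 ∣ m`): `2w = 0` forces `⟨w⟩ ∈ {0, m/2}`, both even. [folklore] -/
private theorem ne_neg_of_odd₆ (hm : m = 6 * n) (h2 : 2 ∣ n) {w : ZMod m} (hw : ¬ 2 ∣ w.val) : w ≠ -w := by
  intro e
  have h2w : (2 * w.val) % m = 0 := by
    have e2 : (2 : ZMod m) * w = 0 := by linear_combination e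
    have := congrArg ZMod.val e2
    rwa [ZMod.val_mul, ZMod.val_zero, show ((2 : ZMod m)).val = 2 by
      rw [show (2 : ZMod m) = ((2 : ℕ) : ZMod m) by norm_cast, ZMod.val_natCast,
        Nat.mod_eq_of_lt (by have := NeZero.pos m; omega)]] at this
  have hlt := ZMod.val_lt w
  obtain ⟨n', hn'⟩ := h2
  rcases Nat.lt_or_ge (2 * w.val) m with h | h
  · rw [Nat.mod_eq_of_lt h] at h2w
    exact hw ⟨0, by omega⟩
  · rw [Nat.mod_eq_sub_mod h, Nat.mod_eq_of_lt (by omega)] at h2w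
    exact hw ⟨3 * n', by omega⟩

/-- **A unit third.** An odd `x` divisible by `3` has a third `u` (`3u = x`) which is odd and prime to `3`. [folklore] -/
private theorem exists_unit_third₆ (hm : m = 6 * n) (hn : n = 2 ^ i) (hi : 1 ≤ i) {x : ZMod m} (hx : ¬ 2 ∣ x.val)
    (hx3 : 3 ∣ x.val) : ∃ u : ZMod m, 3 * u = x ∧ ¬ 2 ∣ u.val ∧ ¬ 3 ∣ u.val := by
  have hn0 := n_pos₆ hn
  have h2 := two_dvd_n₆ hn hi
  have h3m := three_dvd_m₆ hm
  obtain ⟨q, hq⟩ := hx3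
  set u₀ : ZMod m := ((q : ℕ) : ZMod m) with hu₀
  have hqlt : q < m := by have := ZMod.val_lt x; omega
  have hu₀val : u₀.val = q := by rw [hu₀, ZMod.val_natCast, Nat.mod_eq_of_lt hqlt]
  have h3u₀ : 3 * u₀ = x := by
    rw [hu₀, show (3 : ZMod m) * ((q : ℕ) : ZMod m) = (((3 * q : ℕ)) : ZMod m) by push_cast; ring, ← hq,
      ZMod.natCast_zmod_val]
  have hu₀2 : ¬ 2 ∣ u₀.val := by
    rw [hu₀val]
    intro h
    exact hx (by rw [hq]; exact Dvd.dvd.mul_left h 3)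
  by_cases hu₀3 : 3 ∣ u₀.val
  · refine ⟨u₀ + 𝔯, ?_, ?_, ?_⟩
    · rw [mul_add, h3u₀, h_eq_three_mul₆.2]
      linear_combination six_mul_n₆ hm
    · rwa [dvd_val_add_iff₆ (two_dvd_m₆ hm) u₀ (by rw [val_r₆ hm hn0]; exact ⟨n, rfl⟩)]
    · set ρ := ZMod.castHom h3m (ZMod 3) with hρ
      have hρr : ρ 𝔯 ≠ 0 := by
        rw [map_natCast, Ne, ZMod.natCast_eq_zero_iff]
        intro h
        exact not_three_dvd_n₆ hn ((Nat.Prime.dvd_mul Nat.prime_three).mp h |>.resolve_left (by norm_num))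
      rw [dvd_val_iff_cast₆ h3m, _root_.map_add, (dvd_val_iff_cast₆ h3m u₀).mp hu₀3, zero_add]
      exact hρr
  · exact ⟨u₀, h3u₀, hu₀2, hu₀3⟩

omit [NeZero m] in
/-- A divisor `d ≥ 2` of `3·2ⁱ` is even or divisible by `3`. [folklore] -/
private theorem two_or_three_dvd₆ (hn : n = 2 ^ i) {d : ℕ} (hd2 : 2 ≤ d) (hdN : d ∣ 3 * n) : 2 ∣ d ∨ 3 ∣ d := by
  have hp := Nat.minFac_prime (show d ≠ 1 by omega)
  have hpd : d.minFac ∣ d := Nat.minFac_dvd d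
  rw [hn] at hdN
  rcases (Nat.Prime.dvd_mul hp).mp (dvd_trans hpd hdN) with h | h
  · right
    rwa [← (Nat.prime_dvd_prime_iff_eq hp Nat.prime_three).mp h]
  · left
    rwa [← (Nat.prime_dvd_prime_iff_eq hp Nat.prime_two).mp (Nat.Prime.dvd_of_dvd_pow hp h)]

/-- **No coset.** For `y` odd (`4 ∣ n`), `{2y, z, w}` is not a coset `x′ + (m/3)ℤ` with `2y + z + w = −3n`: summing gives
`3x′ = −3n`, so `3(2y + n) = 0`, `2⟨y⟩ ≡ n (mod 2n)` and `n ∣ 2⟨y⟩`. [folklore] -/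
private theorem not_coset_of_odd₆ (hm : m = 6 * n) (hn : n = 2 ^ i) (hi : 2 ≤ i) {y z w x' : ZMod m} (hy : ¬ 2 ∣ y.val)
    (hx' : (2 * y) ::ₘ z ::ₘ ({w} : Multiset (ZMod m)) =
      x' ::ₘ (x' + ((m / 3 : ℕ) : ZMod m)) ::ₘ {x' + 2 * ((m / 3 : ℕ) : ZMod m)})
    (hsum : 2 * y + (z + w) = -(3 * 𝔫)) : False := by
  have hn0 := n_pos₆ hn
  have h4 := four_dvd_n₆ hn hi
  have h2n : 2 * n ∣ m := ⟨3, by rw [hm]; ring⟩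
  have hR : ((m / 3 : ℕ) : ZMod m) = 2 * 𝔫 := by rw [hm, show 6 * n / 3 = 2 * n by omega]; push_cast; ring
  have h6 := six_mul_n₆ hm
  rw [hR] at hx'
  have hs := congrArg Multiset.sum hx'
  simp only [Multiset.sum_cons, Multiset.sum_singleton] at hs
  have h3x : 3 * x' = -(3 * 𝔫) := by linear_combination -hs + hsum - h6
  have mem : (2 : ZMod m) * y ∈ (x' ::ₘ (x' + 2 * 𝔫) ::ₘ ({x' + 2 * (2 * 𝔫)} : Multiset (ZMod m))) := by
    rw [← hx']; simp
  simp only [Multiset.mem_cons, Multiset.mem_singleton] at mem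
  have h3t : (3 : ZMod m) * (2 * y + 𝔫) = 3 * 0 := by
    rcases mem with e | e | e
    · linear_combination (3 : ZMod m) * e + h3x
    · linear_combination (3 : ZMod m) * e + h3x + h6
    · linear_combination (3 : ZMod m) * e + h3x + 2 * h6
  rw [three_mul_eq_iff₆ hm, ZMod.val_zero, Nat.zero_mod] at h3t
  have hval : (2 * y + 𝔫 : ZMod m) = (((2 * y.val + n : ℕ)) : ZMod m) := by
    push_cast; rw [ZMod.natCast_zmod_val]
  rw [hval, ZMod.val_natCast] at h3t
  have hdvd : 2 * n ∣ (2 * y.val + n) % m := Nat.dvd_of_mod_eq_zero h3t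
  rw [Nat.dvd_mod_iff h2n] at hdvd
  have hn2 : n ∣ 2 * y.val := (Nat.dvd_add_left (dvd_refl n)).mp (dvd_trans (Dvd.intro 2 (by ring)) hdvd)
  obtain ⟨c, hc⟩ := dvd_trans h4 hn2
  exact hy ⟨c, by omega⟩

/-! ### The unit case -/

/-- **The shape of a pair-free Hodge quadruple with a unit member** (`m = 3·2ᵃ`, `a ≥ 6`, given the classification at
level `m/2`): `α_y`, `β_y` or `γ_y` with the unit `y` itself as parameter. Let `s` be a pair-free Hodge `4`-multiset over `ℤ/m`, `m = 6n`, `n = 2ⁱ`, `i ≥ 5`, with a member `y` prime to `m`, and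
assume `T(3n)`. Then `s` is `α_y`, `β_y` or `γ_y`: by `twin_or_gamma_twoPowThree` (part V) `s = γ_y` or `y` is twinned,
`s = {y, y + 3n, z, w}` with `z, w` even (`shape_of_twin_twoPowThree`); the twin transfer (part II, `4 ∣ 3n`) leaves `α_y`,
`β_y`, or three alternatives contradicting `y` odd and prime to `3` (`not_coset_of_odd₆`; `3 ∣ y`; a divisor `d ≥ 2` of `3n`
dividing `⟨y⟩`). This is [Aoki1983, Thm. C] = [Shioda1982PicardFermat, Prop. 4 (Q′)] for the elements of `𝔅²ₘ` with a unit
coordinate at these levels, by this formalisation's route. [cite: Aoki1983, Thm. C p. 47; Prop. 2.2]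
[cite: Shioda1982PicardFermat, Prop. 4 (Q′) p. 729, Lemma 1 (a), (b) p. 728] [cite: AokiShioda1983, Thm. (𝔅²ₘ) (ii) a), b), c)] -/
theorem shape_of_unit_mem_twoPowThree (hm : m = 6 * n) (hn : n = 2 ^ i) (hi : 5 ≤ i)
    (IH₂ : ∀ t : Multiset (ZMod (3 * n)), IsHodgeMultiset t → card t = 4 → ¬ HasPair t →
      IsStdMultiset (3 * n) t ∨ IsSmallLift (3 * n) t)
    {s : Multiset (ZMod m)} (hs : IsHodgeMultiset s) (hcard : card s = 4) (hpf : ¬ HasPair s) {y : ZMod m}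
    (hy : y ∈ s) (hy2 : ¬ 2 ∣ y.val) (hy3 : ¬ 3 ∣ y.val) :
    s = {y, y + 3 * 𝔫, -(2 * y), 3 * 𝔫} ∨ s = {y, y + 3 * 𝔫, 2 * y + 3 * 𝔫, -(4 * y)} ∨
      s = {y, y + 2 * 𝔫, y + 4 * 𝔫, -(3 * y)} := by
  classical
  have hn0 : 0 < n := n_pos₆ hn
  haveI : NeZero (3 * n) := ⟨by omega⟩
  have h2m : 2 ∣ m := two_dvd_m₆ hm
  have h3m : 3 ∣ m := three_dvd_m₆ hm
  have hH : ((m / 2 : ℕ) : ZMod m) = 3 * 𝔫 := by rw [hm, show 6 * n / 2 = 3 * n by omega]; push_cast; ring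
  have hR : ((m / 3 : ℕ) : ZMod m) = 2 * 𝔫 := by rw [hm, show 6 * n / 3 = 2 * n by omega]; push_cast; ring
  have h32 : 32 ≤ n := by
    rw [hn]
    calc (32 : ℕ) = 2 ^ 5 := by norm_num
      _ ≤ 2 ^ i := Nat.pow_le_pow_right two_pos hi
  rcases twin_or_gamma_twoPowThree hm hn (by omega) hs hcard hpf hy hy2 hy3 with htwin | hγ
  · obtain ⟨z, w, hs4, hzw, ⟨hz2, hw2⟩, -⟩ := shape_of_twin_twoPowThree hm hn (by omega) hs hcard hpf hy hy2 hy3 htwin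
    have hmN : m = 2 * (3 * n) := by rw [hm]; ring
    have hN3 : (((3 * n : ℕ)) : ZMod m) = 3 * 𝔫 := by push_cast; ring
    have hsx : s = y ::ₘ (y + (((3 * n : ℕ)) : ZMod m)) ::ₘ {z, w} := by rw [hN3]; exact hs4
    have h2N : 2 ∣ 3 * n := Dvd.dvd.mul_left (two_dvd_n₆ hn (by omega)) 3
    have h3N : 3 ∣ 3 * n := Dvd.intro n rfl
    have h4N : 4 ∣ 3 * n := Dvd.dvd.mul_left (four_dvd_n₆ hn (by omega)) 3
    have h72 : 72 < 3 * n := by omega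
    rcases twin_transfer hmN h2N h3N (Or.inl h4N) h72 IH₂ hs hpf hsx (by omega) (Nat.mod_eq_zero_of_dvd hz2)
      (Nat.mod_eq_zero_of_dvd hw2) with hA | hB | ⟨x', hx'⟩ | ⟨hy3', -, -⟩ | ⟨d, hd2, hdN, hdy, -, -⟩
    · -- `s = α_y`
      refine Or.inl ?_
      rw [hN3] at hA
      rw [hs4]
      simp only [Multiset.insert_eq_cons, hA]
    · -- `s = β_y`
      refine Or.inr (Or.inl ?_)
      rw [hN3] at hB
      rw [hs4]
      simp only [Multiset.insert_eq_cons, hB]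
    · exact (not_coset_of_odd₆ hm hn (by omega) hy2 hx' (by linear_combination hzw)).elim
    · exact absurd hy3' hy3
    · exfalso
      rcases two_or_three_dvd₆ hn hd2 hdN with h | h
      · exact hy2 (dvd_trans h hdy)
      · exact hy3 (dvd_trans h hdy)
  · -- `s = γ_y`
    exact Or.inr (Or.inr (by rw [hγ]; rfl))

/-- **A pair-free Hodge quadruple with a unit member is standard** (`m = 3·2ᵃ`, `a ≥ 6`, given `T(m/2)`): `IsStdMultiset`, from
`shape_of_unit_mem_twoPowThree`. [cite: Aoki1983, Thm. C p. 47] [cite: Shioda1982PicardFermat, Prop. 4 (Q′) p. 729, Lemma 1 (a), (b)]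
[cite: AokiShioda1983, Thm. (𝔅²ₘ) (ii) a), b), c)] -/
theorem isStdMultiset_of_unit_mem_twoPowThree (hm : m = 6 * n) (hn : n = 2 ^ i) (hi : 5 ≤ i)
    (IH₂ : ∀ t : Multiset (ZMod (3 * n)), IsHodgeMultiset t → card t = 4 → ¬ HasPair t →
      IsStdMultiset (3 * n) t ∨ IsSmallLift (3 * n) t)
    {s : Multiset (ZMod m)} (hs : IsHodgeMultiset s) (hcard : card s = 4) (hpf : ¬ HasPair s) {y : ZMod m}
    (hy : y ∈ s) (hy2 : ¬ 2 ∣ y.val) (hy3 : ¬ 3 ∣ y.val) : IsStdMultiset m s := by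
  have hn0 : 0 < n := n_pos₆ hn
  have h2m : 2 ∣ m := two_dvd_m₆ hm
  have h3m : 3 ∣ m := three_dvd_m₆ hm
  have hH : ((m / 2 : ℕ) : ZMod m) = 3 * 𝔫 := by rw [hm, show 6 * n / 2 = 3 * n by omega]; push_cast; ring
  have hR : ((m / 3 : ℕ) : ZMod m) = 2 * 𝔫 := by rw [hm, show 6 * n / 3 = 2 * n by omega]; push_cast; ring
  rcases shape_of_unit_mem_twoPowThree hm hn hi IH₂ hs hcard hpf hy hy2 hy3 with h | h | h
  · exact ⟨y, Or.inl ⟨h2m, Or.inl (by rw [hH]; exact h)⟩⟩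
  · exact ⟨y, Or.inl ⟨h2m, Or.inr (by rw [hH]; exact h)⟩⟩
  · exact ⟨y, Or.inr ⟨h3m, by rw [hR, show (2 : ZMod m) * (2 * 𝔫) = 4 * 𝔫 by ring]; exact h⟩⟩

/-- **… and a standard quadruple** (unit multiple of Meyer–Neutsch's `L₁, L₂, L₃`): the parameter `y` is a unit.
[cite: MeyerNeutsch1981Fermatquadrupel, (13)–(15) p. 53] [cite: Shioda1982PicardFermat, Lemma 1 (a), (b) p. 728] -/
theorem isStandardQuadruple_of_unit_mem_twoPowThree (hm : m = 6 * n) (hn : n = 2 ^ i) (hi : 5 ≤ i)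
    (IH₂ : ∀ t : Multiset (ZMod (3 * n)), IsHodgeMultiset t → card t = 4 → ¬ HasPair t →
      IsStdMultiset (3 * n) t ∨ IsSmallLift (3 * n) t)
    {s : Multiset (ZMod m)} (hs : IsHodgeMultiset s) (hcard : card s = 4) (hpf : ¬ HasPair s) {y : ZMod m}
    (hy : y ∈ s) (hy2 : ¬ 2 ∣ y.val) (hy3 : ¬ 3 ∣ y.val) : IsStandardQuadruple m s := by
  have h2m : 2 ∣ m := two_dvd_m₆ hm
  have h3m : 3 ∣ m := three_dvd_m₆ hm
  have hcop : Nat.Coprime y.val m := by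
    have hm' : m = 2 ^ (i + 1) * 3 := by rw [hm, hn]; ring
    have key : Nat.Coprime y.val (2 ^ (i + 1) * 3) :=
      Nat.Coprime.mul_right (Nat.Coprime.pow_right _ ((Nat.Prime.coprime_iff_not_dvd Nat.prime_two).mpr hy2).symm)
        ((Nat.Prime.coprime_iff_not_dvd Nat.prime_three).mpr hy3).symm
    rwa [← hm'] at key
  set t := ZMod.unitOfCoprime y.val hcop with ht
  have hty : (t : ZMod m) = y := by rw [ht, ZMod.coe_unitOfCoprime, ZMod.natCast_zmod_val]
  have hK : m = 2 * (3 * n) := by rw [hm]; ring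
  have hRn : m = 3 * (2 * n) := by rw [hm]; ring
  have e3 : (((3 * n : ℕ)) : ZMod m) = 3 * 𝔫 := by push_cast; ring
  have e2 : (((2 * n : ℕ)) : ZMod m) = 2 * 𝔫 := by push_cast; ring
  rcases shape_of_unit_mem_twoPowThree hm hn hi IH₂ hs hcard hpf hy hy2 hy3 with h | h | h
  · exact ⟨t, Or.inl ⟨h2m, Or.inl (by rw [map_unit_stdOne hK, hty, e3, h])⟩⟩
  · exact ⟨t, Or.inl ⟨h2m, Or.inr (by rw [map_unit_stdTwo hK, hty, e3, h])⟩⟩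
  · refine ⟨t, Or.inr ⟨h3m, ?_⟩⟩
    rw [map_unit_stdThree hRn, hty, e2, h, show (2 : ZMod m) * (2 * 𝔫) = 4 * 𝔫 by ring]


/-! ### All members divisible by `3`: division by `3` to the level `2ᵃ` -/

omit [NeZero m] in
/-- `⟨liftBy k⟩ = 3⟨k⟩` for the lift `ℤ/L → ℤ/3L`. [folklore] -/
private theorem val_liftBy₆ {L : ℕ} [NeZero L] (hmL : m = L * 3) (k : ZMod L) : (liftBy m L 3 k).val = k.val * 3 := by
  rw [liftBy, ZMod.val_natCast, Nat.mod_eq_of_lt (by rw [hmL]; have := ZMod.val_lt k; nlinarith)]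

omit [NeZero m] in
/-- The lift `ℤ/L → ℤ/3L` is injective. [folklore] -/
private theorem liftBy_injective₆ {L : ℕ} [NeZero L] (hmL : m = L * 3) : Function.Injective (liftBy m L 3) := by
  intro a b h
  have := congrArg ZMod.val h
  rw [val_liftBy₆ hmL, val_liftBy₆ hmL] at this
  exact ZMod.val_injective L (by omega)

omit [NeZero m] in
/-- The lift `ℤ/L → ℤ/3L` is additive. [folklore] -/
private theorem liftBy_add₆ {L : ℕ} [NeZero L] (hmL : m = L * 3) (a b : ZMod L) :
    liftBy m L 3 (a + b) = liftBy m L 3 a + liftBy m L 3 b := by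
  rw [liftBy, liftBy, liftBy, ZMod.val_add, ← Nat.mul_mod_mul_right, ← hmL, ZMod.natCast_mod]
  push_cast
  ring

omit [NeZero m] in
/-- The lift `ℤ/L → ℤ/3L` commutes with negation. [folklore] -/
private theorem liftBy_neg₆ {L : ℕ} [NeZero L] (hmL : m = L * 3) (a : ZMod L) : liftBy m L 3 (-a) = -liftBy m L 3 a := by
  have h0 : liftBy m L 3 0 = 0 := by simp [liftBy]
  have := liftBy_add₆ hmL (-a) a
  rw [neg_add_cancel, h0] at this
  linear_combination -this

omit [NeZero m] in
/-- The lift of a double and of a quadruple. [folklore] -/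
private theorem liftBy_two_mul₆ {L : ℕ} [NeZero L] (hmL : m = L * 3) (a : ZMod L) :
    liftBy m L 3 (2 * a) = 2 * liftBy m L 3 a ∧ liftBy m L 3 (4 * a) = 4 * liftBy m L 3 a := by
  have h2 : liftBy m L 3 (2 * a) = 2 * liftBy m L 3 a := by rw [two_mul, two_mul, liftBy_add₆ hmL]
  refine ⟨h2, ?_⟩
  rw [show (4 : ZMod L) * a = 2 * a + 2 * a by ring, liftBy_add₆ hmL, h2]
  ring

/-- **All members divisible by `3`, one of them odd: `s = α_{3x′}` or `β_{3x′}`.** Let `m = 6n = 3·2ⁱ⁺¹` (`i ≥ 1`) and let `s` be a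
pair-free Hodge `4`-multiset over `ℤ/m` whose members are all divisible by `3`, one of them odd. Then `s = 3·s′` for a pair-free
Hodge `4`-multiset `s′` of level `2ⁱ⁺¹` (`isHodgeMultiset_map_liftBy_iff`: [Shioda1982PicardFermat, §2, `𝔍ₘ(d) ≅ 𝔍_{m/d}(1)`])
with an odd member, hence primitive; there is no exceptional quadruple at a level `2ᵏ` ([Shioda1982PicardFermat, Thm. 6 (c)],
`not_isExceptionalQuadruple_two_pow`), so `s′` is a standard quadruple, `α_{x′}` or `β_{x′}`, and `s = α_{3x′}` or `β_{3x′}`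
(`3·(2ⁱ⁺¹/2) = m/2`). [cite: Shioda1982PicardFermat, Thm. 6 (c) p. 731, §2 p. 726, Lemma 1 (a) p. 728]
[cite: AokiShioda1983, Thm. (𝔅²ₘ) (ii) a), b)] -/
theorem isStdMultiset_of_forall_three_dvd_twoPowThree (hm : m = 6 * n) (hn : n = 2 ^ i)
    {s : Multiset (ZMod m)} (hs : IsHodgeMultiset s) (hcard : card s = 4) (hpf : ¬ HasPair s)
    (h3 : ∀ a ∈ s, 3 ∣ a.val) (hodd : ∃ a ∈ s, ¬ 2 ∣ a.val) : IsStdMultiset m s := by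
  classical
  set L : ℕ := 2 ^ (i + 1) with hL
  haveI : NeZero L := ⟨by rw [hL]; positivity⟩
  have hmL : m = L * 3 := by rw [hm, hn, hL]; ring
  have h2m : 2 ∣ m := two_dvd_m₆ hm
  set s' : Multiset (ZMod L) := s.map (fun w ↦ ((w.val / 3 : ℕ) : ZMod L)) with hs'
  -- `s = 3·s′`
  have hdiv : ∀ w ∈ s, (((w.val / 3 : ℕ) : ZMod L)).val = w.val / 3 := fun w hw ↦ by
    rw [ZMod.val_natCast, Nat.mod_eq_of_lt (Nat.div_lt_of_lt_mul (by rw [mul_comm, ← hmL]; exact ZMod.val_lt w))]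
  have hℓw : ∀ w ∈ s, liftBy m L 3 (((w.val / 3 : ℕ) : ZMod L)) = w := fun w hw ↦ by
    rw [liftBy, hdiv w hw, Nat.div_mul_cancel (h3 w hw), ZMod.natCast_zmod_val]
  have hss' : s'.map (liftBy m L 3) = s := by
    rw [hs', Multiset.map_map]
    conv_rhs => rw [← Multiset.map_id s]
    exact Multiset.map_congr rfl fun w hw ↦ hℓw w hw
  -- `s′` is a pair-free Hodge quadruple with an odd member
  have hs'H : IsHodgeMultiset s' := (isHodgeMultiset_map_liftBy_iff hmL three_pos s').mp (by rw [hss']; exact hs)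
  have hs'card : card s' = 4 := by rw [hs', Multiset.card_map, hcard]
  have hs'pf : ¬ HasPair s' := by
    rintro ⟨a, ha, hna⟩
    apply hpf
    refine ⟨liftBy m L 3 a, by rw [← hss']; exact Multiset.mem_map_of_mem _ ha, ?_⟩
    rw [← hss', ← Multiset.map_erase _ (liftBy_injective₆ hmL), ← liftBy_neg₆ hmL]
    exact Multiset.mem_map_of_mem _ hna
  obtain ⟨a, ha, ha2⟩ := hodd
  have ha' : (((a.val / 3 : ℕ) : ZMod L)) ∈ s' := by rw [hs']; exact Multiset.mem_map_of_mem _ ha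
  have hcop : Nat.Coprime (((a.val / 3 : ℕ) : ZMod L)).val L := by
    rw [hdiv a ha, hL]
    refine (Nat.coprime_two_right.mpr ?_).pow_right _
    rw [Nat.odd_iff]
    have e := Nat.div_mul_cancel (h3 a ha)
    by_contra hne
    exact ha2 ⟨a.val / 3 / 2 * 3, by omega⟩
  have hprim : IsPrimitive L s' := isPrimitive_of_coprime_mem ha' hcop
  have hstd : IsStandardQuadruple L s' := by
    by_contra hns
    exact not_isExceptionalQuadruple_two_pow (k := i + 1) (by omega) s' ⟨hs'card, hs'H, hs'pf, hprim, hns⟩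
  -- read it back at level `m`
  have hH : liftBy m L 3 (((L / 2 : ℕ)) : ZMod L) = ((m / 2 : ℕ) : ZMod m) := by
    rw [liftBy, ZMod.val_natCast, Nat.mod_eq_of_lt (Nat.div_lt_self (NeZero.pos L) one_lt_two), hmL, hL,
      pow_succ, Nat.mul_div_cancel _ two_pos, show 2 ^ i * 2 * 3 / 2 = 2 ^ i * 3 by
        rw [show 2 ^ i * 2 * 3 = (2 ^ i * 3) * 2 by ring, Nat.mul_div_cancel _ two_pos]]
  obtain ⟨x', ⟨-, hα | hβ⟩ | ⟨h3L, -⟩⟩ := isStdMultiset_of_isStandardQuadruple hstd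
  · refine ⟨liftBy m L 3 x', Or.inl ⟨h2m, Or.inl ?_⟩⟩
    rw [← hss', hα]
    simp only [Multiset.insert_eq_cons, Multiset.map_cons, Multiset.map_singleton, liftBy_add₆ hmL, liftBy_neg₆ hmL, hH,
      (liftBy_two_mul₆ hmL x').1]
  · refine ⟨liftBy m L 3 x', Or.inl ⟨h2m, Or.inr ?_⟩⟩
    rw [← hss', hβ]
    simp only [Multiset.insert_eq_cons, Multiset.map_cons, Multiset.map_singleton, liftBy_add₆ hmL, liftBy_neg₆ hmL, hH,
      (liftBy_two_mul₆ hmL x').1, (liftBy_two_mul₆ hmL x').2]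
  · exfalso
    rw [hL] at h3L
    have := Nat.Prime.dvd_of_dvd_pow Nat.prime_three h3L
    omega


/-! ### No mixed quadruple -/

/-- **No mixed quadruple at the levels `3·2ᵃ`** (`a ≥ 6`, given `T(m/2)`). A pair-free Hodge `4`-multiset over `ℤ/m`,
`m = 6n`, `n = 2ⁱ`, `i ≥ 5`, all of whose members are even or divisible by `3`, cannot contain both an odd member and a member
prime to `3`. PROOF: it would be `{u₁, u₂, v₁, v₂}` with `uᵢ` odd multiples of `3` and `vᵢ` even, prime to `3` (`mixed_shape`);
the third relation (part V) at `x = u₁` — whose unit partners `u₁ + 2n` and a unit third of `u₁` carry no charge, all members of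
their groups being units — gives `d(u₁) = 0`, so `u₁ + 3n ∈ s`, `u₂ = u₁ + 3n`; the twin transfer at `y = u₁` (part II, `4 ∣ 3n`)
then puts a multiple of `3` among the `vᵢ` (alternatives (i), (ii), (iv), (v): `3n`, `−4u₁`, `3 ∣ v₁`, `d = 3 ∣ ⟨v₁⟩/2`; an even
`d` would divide the odd `⟨u₁⟩`) or makes `{2u₁, v₁, v₂}` a coset of `(m/3)ℤ` (`not_coset_of_odd₆`). This formalisation's
lemma towards [Aoki1983, Thm. C] at the levels `3·2ᵃ`. [cite: Aoki1983, Thm. C p. 47; Prop. 2.2]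
[cite: Shioda1982PicardFermat, Prop. 4 (Q′) p. 729] -/
theorem no_mixed_twoPowThree (hm : m = 6 * n) (hn : n = 2 ^ i) (hi : 5 ≤ i)
    (IH₂ : ∀ t : Multiset (ZMod (3 * n)), IsHodgeMultiset t → card t = 4 → ¬ HasPair t →
      IsStdMultiset (3 * n) t ∨ IsSmallLift (3 * n) t)
    {s : Multiset (ZMod m)} (hs : IsHodgeMultiset s) (hcard : card s = 4) (hpf : ¬ HasPair s)
    (hnu : ∀ a ∈ s, 2 ∣ a.val ∨ 3 ∣ a.val) (hodd : ∃ a ∈ s, ¬ 2 ∣ a.val) (hthree : ∃ a ∈ s, ¬ 3 ∣ a.val) : False := by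
  classical
  have hn0 : 0 < n := n_pos₆ hn
  haveI : NeZero (3 * n) := ⟨by omega⟩
  have hi1 : 1 ≤ i := by omega
  have h2 : 2 ∣ n := two_dvd_n₆ hn hi1
  have h2m : 2 ∣ m := two_dvd_m₆ hm
  have h3m : 3 ∣ m := three_dvd_m₆ hm
  have h2n : 2 * n ∣ m := ⟨3, by rw [hm]; ring⟩
  obtain ⟨eh, er⟩ := h_eq_three_mul₆ (m := m) (n := n)
  have h6 := six_mul_n₆ hm
  have h32 : 32 ≤ n := by
    rw [hn]
    calc (32 : ℕ) = 2 ^ 5 := by norm_num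
      _ ≤ 2 ^ i := Nat.pow_le_pow_right two_pos hi
  obtain ⟨u₁, u₂, v₁, v₂, hsx, hu₁, hu₂, hv₁, hv₂⟩ := mixed_shape h2m h3m hs hcard hnu hodd hthree
  -- `d` vanishes on units: all members of a unit's group are units
  have hnot : ∀ g : ZMod m, ¬ 2 ∣ g.val → ¬ 3 ∣ g.val → g ∉ s := fun g hg2 hg3 hgs ↦ by
    rcases hnu g hgs with h | h
    · exact hg2 h
    · exact hg3 h
  have hd0 : ∀ w : ZMod m, ¬ 2 ∣ w.val → ¬ 3 ∣ w.val → 𝔡[s, w] = 0 := by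
    intro w hw2 hw3
    obtain ⟨a2, b2, c2⟩ := odd_points₆ hm hn0 h2 hw2
    obtain ⟨a3, b3, c3⟩ := prime_three_points₆ hm hn0 hw3
    rw [Multiset.count_eq_zero.mpr (hnot w hw2 hw3), Multiset.count_eq_zero.mpr (hnot _ a2 a3),
      Multiset.count_eq_zero.mpr (hnot _ b2 b3), Multiset.count_eq_zero.mpr (hnot _ c2 c3)]
    simp
  -- the third relation at `u₁`
  have hu₁r2 : ¬ 2 ∣ (u₁ + 𝔯).val := by
    rw [dvd_val_add_iff₆ h2m u₁ (by rw [val_r₆ hm hn0]; exact ⟨n, rfl⟩)]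
    exact hu₁.1
  have hu₁r3 : ¬ 3 ∣ (u₁ + 𝔯).val := by
    set ρ := ZMod.castHom h3m (ZMod 3) with hρ
    have hρr : ρ 𝔯 ≠ 0 := by
      rw [map_natCast, Ne, ZMod.natCast_eq_zero_iff]
      intro h
      exact not_three_dvd_n₆ hn ((Nat.Prime.dvd_mul Nat.prime_three).mp h |>.resolve_left (by norm_num))
    rw [dvd_val_iff_cast₆ h3m, _root_.map_add, (dvd_val_iff_cast₆ h3m u₁).mp hu₁.2, zero_add]
    exact hρr
  have hcl : u₁.val % (2 * n) = (u₁ + 𝔯).val % (2 * n) := (mod_add_of_dvd₆ h2n u₁ (by rw [val_r₆ hm hn0])).symm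
  obtain ⟨u, hux, hu2', hu3'⟩ := exists_unit_third₆ hm hn hi1 hu₁.1 hu₁.2
  have R2 := countSub_third_twoPowThree hm hn hi1 hs hu₁.1 hu₁r2 hu₁r3 hu2' hu3' hcl hux
  rw [hd0 _ hu₁r2 hu₁r3, hd0 _ hu2' hu3', sub_zero, add_zero] at R2
  -- so `u₁ + 3n ∈ s`, and it is `u₂`
  have hu₁s : u₁ ∈ s := by rw [hsx]; simp
  have a1 : 1 ≤ count u₁ s := Multiset.one_le_count_iff_mem.mpr hu₁s
  have n0 : count (-u₁) s = 0 := by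
    by_contra h
    exact hpf ⟨u₁, hu₁s, (Multiset.mem_erase_of_ne (ne_neg_of_odd₆ hm h2 hu₁.1).symm).mpr
      (Multiset.count_pos.mp (Nat.pos_of_ne_zero h))⟩
  have hBs : u₁ + 𝔥 ∈ s := Multiset.count_pos.mp (by
    have := Int.natCast_nonneg (count (-(u₁ + 𝔥)) s)
    omega)
  obtain ⟨-, hB2, -⟩ := odd_points₆ hm hn0 h2 hu₁.1
  have hB : u₂ = u₁ + 𝔥 := by
    rw [hsx] at hBs
    simp only [Multiset.insert_eq_cons, Multiset.mem_cons, Multiset.mem_singleton] at hBs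
    rcases hBs with h | h | h | h
    · exfalso
      have : (𝔥 : ZMod m) = 0 := by linear_combination h
      have := congrArg ZMod.val this
      rw [val_h₆ hm hn0, ZMod.val_zero] at this
      omega
    · exact h.symm
    · exact absurd (h ▸ hv₁.1) hB2
    · exact absurd (h ▸ hv₂.1) hB2
  -- the twin transfer at `y = u₁`
  have hmN : m = 2 * (3 * n) := by rw [hm]; ring
  have hsx' : s = u₁ ::ₘ (u₁ + (((3 * n : ℕ)) : ZMod m)) ::ₘ {v₁, v₂} := by rw [hsx, hB]
  have h2N : 2 ∣ 3 * n := Dvd.dvd.mul_left h2 3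
  have h3N : 3 ∣ 3 * n := Dvd.intro n rfl
  have h4N : 4 ∣ 3 * n := Dvd.dvd.mul_left (four_dvd_n₆ hn (by omega)) 3
  have h72 : 72 < 3 * n := by omega
  have hv3 : ∀ v : ZMod m, v = v₁ ∨ v = v₂ → ¬ 3 ∣ v.val := by
    rintro v (rfl | rfl)
    · exact hv₁.2
    · exact hv₂.2
  have hu₁1 : u₁.val % 2 = 1 := by have := hu₁.1; omega
  rcases twin_transfer hmN h2N h3N (Or.inl h4N) h72 IH₂ hs hpf hsx' hu₁1 (Nat.mod_eq_zero_of_dvd hv₁.1)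
    (Nat.mod_eq_zero_of_dvd hv₂.1) with hA | hB' | ⟨x', hx'⟩ | ⟨-, hv3', -⟩ | ⟨d, hd2, hdN, hdu, hdv, -⟩
  · -- `3n ∈ {v₁, v₂}`
    have mem : (𝔥 : ZMod m) ∈ (v₁ ::ₘ ({v₂} : Multiset (ZMod m))) := by rw [hA]; simp
    simp only [Multiset.mem_cons, Multiset.mem_singleton] at mem
    exact hv3 𝔥 mem (by rw [val_h₆ hm hn0]; exact Dvd.intro n rfl)
  · -- `−4u₁ ∈ {v₁, v₂}`
    have mem : -(4 * u₁) ∈ (v₁ ::ₘ ({v₂} : Multiset (ZMod m))) := by rw [hB']; simp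
    simp only [Multiset.mem_cons, Multiset.mem_singleton] at mem
    refine hv3 _ mem ?_
    rw [dvd_val_neg_iff₆ h3m, show (4 : ZMod m) * u₁ = (((4 * u₁.val : ℕ)) : ZMod m) by
      push_cast; rw [ZMod.natCast_zmod_val], ZMod.val_natCast]
    exact (Nat.dvd_mod_iff h3m).mpr (Dvd.dvd.mul_left hu₁.2 4)
  · -- a coset
    refine not_coset_of_odd₆ hm hn (by omega) hu₁.1 hx' ?_
    have hsum : s.sum = 0 := hs.1.2
    rw [hsx', eh] at hsum
    simp only [Multiset.insert_eq_cons, Multiset.sum_cons, Multiset.sum_singleton] at hsum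
    linear_combination hsum
  · exact hv₁.2 hv3'
  · rcases two_or_three_dvd₆ hn hd2 hdN with h | h
    · exact hu₁.1 (dvd_trans h hdu)
    · exact hv₁.2 (by rw [← Nat.div_mul_cancel hv₁.1]; exact Dvd.dvd.mul_right (dvd_trans h hdv) 2)

/-! ### The inductive step, the base, the induction -/

/-- **The step `T(3·2ᵃ⁻¹) ⟹ T(3·2ᵃ)`** (`a ≥ 6`): a pair-free Hodge `4`-multiset over `ℤ/3·2ᵃ` is standard or a lift from a
level `≤ 72` — by the unit case, the all-even case (part II, `std_or_small_of_all_even`), the all-divisible-by-`3` case and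
the absence of mixed quadruples. [cite: Aoki1983, Thm. C p. 47] [cite: Shioda1982PicardFermat, Prop. 4 (Q′) p. 729]
[cite: AokiShioda1983, Thm. (𝔅²ₘ) (ii)] -/
theorem std_or_small_twoPowThree (hm : m = 6 * n) (hn : n = 2 ^ i) (hi : 5 ≤ i) (IH₂ : StdOrSmall (3 * n))
    {s : Multiset (ZMod m)} (hs : IsHodgeMultiset s) (hcard : card s = 4) (hpf : ¬ HasPair s) :
    IsStdMultiset m s ∨ IsSmallLift m s := by
  haveI : NeZero (3 * n) := ⟨by have := n_pos₆ hn; omega⟩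
  have h2N : 2 ∣ 3 * n := Dvd.dvd.mul_left (two_dvd_n₆ hn (by omega)) 3
  have h3N : 3 ∣ 3 * n := Dvd.intro n rfl
  by_cases hunit : ∃ y ∈ s, ¬ 2 ∣ y.val ∧ ¬ 3 ∣ y.val
  · obtain ⟨y, hy, hy2, hy3⟩ := hunit
    exact Or.inl (isStdMultiset_of_unit_mem_twoPowThree hm hn hi IH₂ hs hcard hpf hy hy2 hy3)
  push Not at hunit
  have hnu : ∀ a ∈ s, 2 ∣ a.val ∨ 3 ∣ a.val := fun a ha ↦ by
    by_cases h : 2 ∣ a.val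
    · exact Or.inl h
    · exact Or.inr (hunit a ha h)
  by_cases heven : ∀ a ∈ s, 2 ∣ a.val
  · exact std_or_small_of_all_even (N := 3 * n) (by rw [hm]; ring) h2N h3N IH₂ hs hcard hpf heven
  push Not at heven
  by_cases hthree : ∀ a ∈ s, 3 ∣ a.val
  · exact Or.inl (isStdMultiset_of_forall_three_dvd_twoPowThree hm hn hs hcard hpf hthree heven)
  push Not at hthree
  exact (no_mixed_twoPowThree hm hn hi IH₂ hs hcard hpf hnu heven hthree).elim

/-- **`T(96)`**: no row `96` in [MeyerNeutsch1981Fermatquadrupel, Tabelle 1] (kernel census up to `180`).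
[cite: MeyerNeutsch1981Fermatquadrupel, Tabelle 1 p. 54] [cite: Shioda1982PicardFermat, table p. 727] -/
theorem stdOrSmall_96 : StdOrSmall 96 :=
  stdOrSmall_of_forall_not_isExceptionalQuadruple (by norm_num)
    (not_isExceptionalQuadruple_of_le_oneHundredEighty 96 (by norm_num) (by norm_num) rfl)

/-- **`T(3·2ᵃ)` for every `a ≥ 2`** — the hypothesis `H₂` of `thmB2m_standard_twoThreePower` (`StandardQuadrupleTwoThreePower`): every pair-free Hodge
`4`-multiset over `ℤ/3·2ᵃ` is `α_x`, `β_x`, `γ_x` or a lift from a level `≤ 72`; i.e. [Aoki1983, Thm. C] =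
[Shioda1982PicardFermat, Prop. 4 (Q′)] at the levels `3·2ᵃ > 72` together with the census of the exceptional levels
`12, 24, 48` below. Induction on `a`: `T(12), T(24), T(48)` are void, `T(96)` is the census, and `std_or_small_twoPowThree` is the
step. [cite: Aoki1983, Thm. C p. 47] [cite: Shioda1982PicardFermat, Prop. 4 (Q′) p. 729] [cite: AokiShioda1983, Thm. (𝔅²ₘ) (ii)]
[cite: MeyerNeutsch1981Fermatquadrupel, Tabelle 1 p. 54] -/
theorem stdOrSmall_twoPowThree {a : ℕ} (ha : 2 ≤ a) : StdOrSmall (2 ^ a * 3) := by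
  induction a using Nat.strong_induction_on with
  | _ a IH =>
    by_cases h4 : a ≤ 4
    · apply stdOrSmall_of_le
      interval_cases a <;> norm_num
    by_cases h5 : a = 5
    · subst h5
      exact stdOrSmall_96
    obtain ⟨a', rfl⟩ : ∃ a', a = a' + 1 := ⟨a - 1, by omega⟩
    have ha' : 5 ≤ a' := by omega
    haveI : NeZero (2 ^ (a' + 1) * 3) := ⟨by positivity⟩
    have IH₂ : StdOrSmall (3 * 2 ^ a') := by rw [mul_comm]; exact IH a' (by omega) (by omega)
    intro t ht hc hp
    exact std_or_small_twoPowThree (m := 2 ^ (a' + 1) * 3) (n := 2 ^ a') (i := a') (by rw [pow_succ]; ring) rfl ha' IH₂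
      ht hc hp

omit [NeZero m] in
/-- A common divisor `q ∣ m` of all representatives divides the iterated `gcd`. [folklore] -/
private theorem dvd_foldr_gcd₆ {q : ℕ} {t : Multiset (ZMod m)} (h : ∀ a ∈ t, q ∣ a.val) (hq : q ∣ m) :
    q ∣ (t.map ZMod.val).foldr Nat.gcd m := by
  induction t using Multiset.induction_on with
  | empty => simpa using hq
  | cons a t ih =>
    rw [Multiset.map_cons, Multiset.foldr_cons]
    exact Nat.dvd_gcd (h a (Multiset.mem_cons_self a t)) (ih fun b hb ↦ h b (Multiset.mem_cons_of_mem hb))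

omit [NeZero m] in
/-- A primitive multiset is not contained in `qℤ/m` for a divisor `q > 1` of `m`. [cite: Shioda1982PicardFermat, §2 p. 726 (GCD)] -/
private theorem not_forall_dvd_of_isPrimitive₆ {q : ℕ} (hq1 : 1 < q) (hq : q ∣ m) {s : Multiset (ZMod m)}
    (hprim : IsPrimitive m s) : ¬ ∀ a ∈ s, q ∣ a.val := fun h ↦ by
  have := dvd_foldr_gcd₆ h hq
  rw [hprim, Nat.dvd_one] at this
  omega

/-- **`Δ(3·2ᵃ) = 0` for `a ≥ 6`, unconditionally**: no exceptional Hodge quadruple at the levels `m = 3·2ᵃ ≥ 192` — a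
primitive pair-free Hodge quadruple has a unit member (it is not inside `2ℤ/m` or `3ℤ/m`, and `no_mixed_twoPowThree`), hence
is a standard quadruple (`isStandardQuadruple_of_unit_mem_twoPowThree` with `T(m/2) = stdOrSmall_twoPowThree`).
[Shioda1982PicardFermat, Prop. 4 (Q′)] = [Aoki1983, Thm. C] at these levels. [cite: Shioda1982PicardFermat, Prop. 4 (Q′) p. 729, table p. 727]
[cite: Aoki1983, Thm. C p. 47] [cite: MeyerNeutsch1981Fermatquadrupel, p. 53] -/
theorem not_isExceptionalQuadruple_twoPowThree (hm : m = 6 * n) (hn : n = 2 ^ i) (hi : 5 ≤ i) (s : Multiset (ZMod m)) :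
    ¬ IsExceptionalQuadruple m s := by
  rintro ⟨hcard, hs, hpf, hprim, hns⟩
  haveI : NeZero (3 * n) := ⟨by have := n_pos₆ hn; omega⟩
  have IH₂ : StdOrSmall (3 * n) := by
    rw [hn, mul_comm]
    exact stdOrSmall_twoPowThree (a := i) (by omega)
  have h2m : 2 ∣ m := two_dvd_m₆ hm
  have h3m : 3 ∣ m := three_dvd_m₆ hm
  by_cases hunit : ∃ y ∈ s, ¬ 2 ∣ y.val ∧ ¬ 3 ∣ y.val
  · obtain ⟨y, hy, hy2, hy3⟩ := hunit
    exact hns (isStandardQuadruple_of_unit_mem_twoPowThree hm hn hi IH₂ hs hcard hpf hy hy2 hy3)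
  push Not at hunit
  have hnu : ∀ a ∈ s, 2 ∣ a.val ∨ 3 ∣ a.val := fun a ha ↦ by
    by_cases h : 2 ∣ a.val
    · exact Or.inl h
    · exact Or.inr (hunit a ha h)
  have heven : ∃ a ∈ s, ¬ 2 ∣ a.val := by
    by_contra h
    push Not at h
    exact not_forall_dvd_of_isPrimitive₆ one_lt_two h2m hprim h
  have hthree : ∃ a ∈ s, ¬ 3 ∣ a.val := by
    by_contra h
    push Not at h
    exact not_forall_dvd_of_isPrimitive₆ (by norm_num) h3m hprim h
  exact no_mixed_twoPowThree hm hn hi IH₂ hs hcard hpf hnu heven hthree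

end TwoPowThreeStd

section TwiceThreePowStd

variable {m n k : ℕ} [NeZero m]

/-- `𝔫 = n = m/6` as a residue modulo `m = 6n`. -/
local notation "𝔫" => (((n : ℕ)) : ZMod m)

omit [NeZero m] in
/-- `0 < n`. [folklore] -/
private theorem n_pos₈ (hn : n = 3 ^ k) : 0 < n := by
  rw [hn]; positivity

omit [NeZero m] in
/-- `3 ∣ n` when `k ≥ 1`. [folklore] -/
private theorem three_dvd_n₈ (hn : n = 3 ^ k) (hk : 1 ≤ k) : 3 ∣ n := by
  obtain ⟨k', rfl⟩ := Nat.exists_eq_add_of_le' hk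
  exact ⟨3 ^ k', by rw [hn]; ring⟩

omit [NeZero m] in
/-- `2 ∣ m`, `3 ∣ m`. [folklore] -/
private theorem two_three_dvd_m₈ (hm : m = 6 * n) : 2 ∣ m ∧ 3 ∣ m := ⟨⟨3 * n, by rw [hm]; ring⟩, ⟨2 * n, by rw [hm]; ring⟩⟩

omit [NeZero m] in
/-- A common divisor `q ∣ m` of all representatives divides the iterated `gcd`. [folklore] -/
private theorem dvd_foldr_gcd₈ {q : ℕ} {t : Multiset (ZMod m)} (h : ∀ a ∈ t, q ∣ a.val) (hq : q ∣ m) :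
    q ∣ (t.map ZMod.val).foldr Nat.gcd m := by
  induction t using Multiset.induction_on with
  | empty => simpa using hq
  | cons a t ih =>
    rw [Multiset.map_cons, Multiset.foldr_cons]
    exact Nat.dvd_gcd (h a (Multiset.mem_cons_self a t)) (ih fun b hb ↦ h b (Multiset.mem_cons_of_mem hb))

omit [NeZero m] in
/-- A primitive multiset is not inside `qℤ/m` for a divisor `q > 1` of `m`. [cite: Shioda1982PicardFermat, §2 p. 726 (GCD)] -/
private theorem not_forall_dvd_of_isPrimitive₈ {q : ℕ} (hq1 : 1 < q) (hq : q ∣ m) {s : Multiset (ZMod m)}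
    (hprim : IsPrimitive m s) : ¬ ∀ a ∈ s, q ∣ a.val := fun h ↦ by
  have := dvd_foldr_gcd₈ h hq
  rw [hprim, Nat.dvd_one] at this
  omega

omit [NeZero m] in
/-- A residue of `ℤ/2·3ᵏ⁺¹` that is odd and prime to `3` is coprime to `m`. [folklore] -/
private theorem coprime_of_unit₈ (hm : m = 6 * n) (hn : n = 3 ^ k) {y : ZMod m} (hy2 : ¬ 2 ∣ y.val) (hy3 : ¬ 3 ∣ y.val) :
    Nat.Coprime y.val m := by
  have hm' : m = 2 * 3 ^ (k + 1) := by rw [hm, hn]; ring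
  have key : Nat.Coprime y.val (2 * 3 ^ (k + 1)) :=
    Nat.Coprime.mul_right ((Nat.Prime.coprime_iff_not_dvd Nat.prime_two).mpr hy2).symm
      (Nat.Coprime.pow_right _ ((Nat.Prime.coprime_iff_not_dvd Nat.prime_three).mpr hy3).symm)
  rwa [← hm'] at key

/-- `3 ∣ ⟨x⟩` gives `3 ∣ ⟨2x⟩`. [folklore] -/
private theorem three_dvd_val_two_mul₈ (hm : m = 6 * n) {x : ZMod m} (h : 3 ∣ x.val) : 3 ∣ ((2 : ZMod m) * x).val := by
  rw [show (2 : ZMod m) * x = (((2 * x.val : ℕ)) : ZMod m) by push_cast; rw [ZMod.natCast_zmod_val], ZMod.val_natCast,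
    Nat.dvd_mod_iff (two_three_dvd_m₈ hm).2]
  exact Dvd.dvd.mul_left h 2

/-! ### The unit case: a standard quadruple with a unit parameter -/

/-- **A pair-free Hodge quadruple with a unit member is a standard quadruple and a standard multiset** (`m = 2·3ᵇ`, `b ≥ 4`):
`shape_of_unit_twiceThreePow` (part VII) gives `γ_y`, `α_y`, `β_y` or `β_x` (`2x = y + 3n`, `x` odd), and the parameter `y`,
resp. `x`, is a unit (odd, prime to `3`): `s = y·L₃, y·L₁, y·L₂, x·L₂`.
[cite: Aoki1983, Thm. C p. 47] [cite: Shioda1982PicardFermat, Lemma 1 (a), (b) p. 728, Prop. 4 (Q′) p. 729]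
[cite: MeyerNeutsch1981Fermatquadrupel, (13)–(15) p. 53] [cite: AokiShioda1983, §2 Thm. (𝔅²ₘ) (ii) a), b), c)] -/
theorem isStandardQuadruple_of_unit_mem_twiceThreePow (hm : m = 6 * n) (hn : n = 3 ^ k) (hk : 3 ≤ k)
    {s : Multiset (ZMod m)} (hs : IsHodgeMultiset s) (hcard : card s = 4) (hpf : ¬ HasPair s) {y : ZMod m} (hy : y ∈ s)
    (hy2 : ¬ 2 ∣ y.val) (hy3 : ¬ 3 ∣ y.val) : IsStandardQuadruple m s ∧ IsStdMultiset m s := by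
  obtain ⟨h2m, h3m⟩ := two_three_dvd_m₈ hm
  have hn0 : 0 < n := n_pos₈ hn
  have hK : m = 2 * (3 * n) := by rw [hm]; ring
  have hRn : m = 3 * (2 * n) := by rw [hm]; ring
  have hH : ((m / 2 : ℕ) : ZMod m) = 3 * 𝔫 := by rw [hm, show 6 * n / 2 = 3 * n by omega]; push_cast; ring
  have hR : ((m / 3 : ℕ) : ZMod m) = 2 * 𝔫 := by rw [hm, show 6 * n / 3 = 2 * n by omega]; push_cast; ring
  have e3 : (((3 * n : ℕ)) : ZMod m) = 3 * 𝔫 := by push_cast; ring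
  have e2 : (((2 * n : ℕ)) : ZMod m) = 2 * 𝔫 := by push_cast; ring
  have e44 : (2 : ZMod m) * (2 * 𝔫) = 4 * 𝔫 := by ring
  set t := ZMod.unitOfCoprime y.val (coprime_of_unit₈ hm hn hy2 hy3) with ht
  have hty : (t : ZMod m) = y := by rw [ht, ZMod.coe_unitOfCoprime, ZMod.natCast_zmod_val]
  rcases shape_of_unit_twiceThreePow hm hn hk hs hcard hpf hy hy2 hy3 with h | h | h | ⟨x, hx, hx2, h⟩
  · -- `γ_y`
    exact ⟨⟨t, Or.inr ⟨h3m, by rw [map_unit_stdThree hRn, hty, e2, h, e44]⟩⟩, ⟨y, Or.inr ⟨h3m, by rw [hR, e44]; exact h⟩⟩⟩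
  · -- `α_y`
    exact ⟨⟨t, Or.inl ⟨h2m, Or.inl (by rw [map_unit_stdOne hK, hty, e3, h])⟩⟩,
      ⟨y, Or.inl ⟨h2m, Or.inl (by rw [hH]; exact h)⟩⟩⟩
  · -- `β_y`
    exact ⟨⟨t, Or.inl ⟨h2m, Or.inr (by rw [map_unit_stdTwo hK, hty, e3, h])⟩⟩,
      ⟨y, Or.inl ⟨h2m, Or.inr (by rw [hH]; exact h)⟩⟩⟩
  · -- `β_x`, `x` odd; `x` is prime to `3` since `2x = y + 3n` is
    have hx3 : ¬ 3 ∣ x.val := by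
      intro h3
      have h2x := three_dvd_val_two_mul₈ hm h3
      rw [hx, ZMod.val_add] at h2x
      have h3n : 3 ∣ ((3 : ZMod m) * 𝔫).val := by
        rw [show (3 : ZMod m) * 𝔫 = (((3 * n : ℕ)) : ZMod m) by push_cast; ring, ZMod.val_natCast]
        exact (Nat.dvd_mod_iff h3m).mpr (Dvd.intro n rfl)
      exact hy3 ((Nat.dvd_add_left h3n).mp ((Nat.dvd_mod_iff h3m).mp h2x))
    set u := ZMod.unitOfCoprime x.val (coprime_of_unit₈ hm hn hx2 hx3) with hu
    have hux : (u : ZMod m) = x := by rw [hu, ZMod.coe_unitOfCoprime, ZMod.natCast_zmod_val]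
    exact ⟨⟨u, Or.inl ⟨h2m, Or.inr (by rw [map_unit_stdTwo hK, hux, e3, h])⟩⟩,
      ⟨x, Or.inl ⟨h2m, Or.inr (by rw [hH]; exact h)⟩⟩⟩

/-! ### All members even, one prime to `3`: halving to the odd level `3ᵇ` -/

omit [NeZero m] in
/-- `⟨liftBy k⟩ = 2⟨k⟩` for the lift `ℤ/L → ℤ/2L`. [folklore] -/
private theorem val_liftBy₈ {L : ℕ} [NeZero L] (hmL : m = L * 2) (a : ZMod L) : (liftBy m L 2 a).val = a.val * 2 := by
  rw [liftBy, ZMod.val_natCast, Nat.mod_eq_of_lt (by rw [hmL]; have := ZMod.val_lt a; nlinarith)]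

omit [NeZero m] in
/-- The lift `ℤ/L → ℤ/2L` is injective. [folklore] -/
private theorem liftBy_injective₈ {L : ℕ} [NeZero L] (hmL : m = L * 2) : Function.Injective (liftBy m L 2) := by
  intro a b h
  have := congrArg ZMod.val h
  rw [val_liftBy₈ hmL, val_liftBy₈ hmL] at this
  exact ZMod.val_injective L (by omega)

omit [NeZero m] in
/-- The lift `ℤ/L → ℤ/2L` is additive. [folklore] -/
private theorem liftBy_add₈ {L : ℕ} [NeZero L] (hmL : m = L * 2) (a b : ZMod L) :
    liftBy m L 2 (a + b) = liftBy m L 2 a + liftBy m L 2 b := by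
  rw [liftBy, liftBy, liftBy, ZMod.val_add, ← Nat.mul_mod_mul_right, ← hmL, ZMod.natCast_mod]
  push_cast
  ring

omit [NeZero m] in
/-- The lift `ℤ/L → ℤ/2L` commutes with negation. [folklore] -/
private theorem liftBy_neg₈ {L : ℕ} [NeZero L] (hmL : m = L * 2) (a : ZMod L) : liftBy m L 2 (-a) = -liftBy m L 2 a := by
  have h0 : liftBy m L 2 0 = 0 := by simp [liftBy]
  have := liftBy_add₈ hmL (-a) a
  rw [neg_add_cancel, h0] at this
  linear_combination -this

omit [NeZero m] in
/-- The lift of a double and of a triple. [folklore] -/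
private theorem liftBy_mul₈ {L : ℕ} [NeZero L] (hmL : m = L * 2) (a : ZMod L) :
    liftBy m L 2 (2 * a) = 2 * liftBy m L 2 a ∧ liftBy m L 2 (3 * a) = 3 * liftBy m L 2 a := by
  have h2 : liftBy m L 2 (2 * a) = 2 * liftBy m L 2 a := by rw [two_mul, two_mul, liftBy_add₈ hmL]
  refine ⟨h2, ?_⟩
  rw [show (3 : ZMod L) * a = 2 * a + a by ring, liftBy_add₈ hmL, h2]
  ring

/-- **All members even, one prime to `3`: `s = γ_{2x′}`.** Let `m = 6n = 2·3ᵏ⁺¹` and let `s` be a pair-free Hodge `4`-multiset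
over `ℤ/m` whose members are all even, one of them prime to `3`. Then `s = 2·s′` for a pair-free Hodge `4`-multiset `s′` of
the odd level `3ᵏ⁺¹` (`isHodgeMultiset_map_liftBy_iff`: [Shioda1982PicardFermat, §2, `𝔍ₘ(d) ≅ 𝔍_{m/d}(1)`]) with a member
prime to `3`, hence primitive; there is no exceptional quadruple at a level `3ᵏ` ([Shioda1982PicardFermat, Thm. 6 (b)],
`not_isExceptionalQuadruple_three_pow`), so `s′` is standard, `= γ_{x′}` (the level is odd), and `s = γ_{2x′}`
(`2·(3ᵏ⁺¹/3) = m/3`). [cite: Shioda1982PicardFermat, Thm. 6 (b) p. 731, §2 p. 726, Lemma 1 (b) p. 728]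
[cite: AokiShioda1983, Thm. (𝔅²ₘ) (ii) c)] -/
theorem isStdMultiset_of_forall_even_twiceThreePow (hm : m = 6 * n) (hn : n = 3 ^ k) {s : Multiset (ZMod m)}
    (hs : IsHodgeMultiset s) (hcard : card s = 4) (hpf : ¬ HasPair s) (heven : ∀ a ∈ s, 2 ∣ a.val)
    (hthree : ∃ a ∈ s, ¬ 3 ∣ a.val) : IsStdMultiset m s := by
  classical
  set L : ℕ := 3 ^ (k + 1) with hL
  haveI : NeZero L := ⟨by rw [hL]; positivity⟩
  have hmL : m = L * 2 := by rw [hm, hn, hL]; ring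
  have h3m : 3 ∣ m := (two_three_dvd_m₈ hm).2
  set s' : Multiset (ZMod L) := s.map (fun w ↦ ((w.val / 2 : ℕ) : ZMod L)) with hs'
  -- `s = 2·s′`
  have hdiv : ∀ w ∈ s, (((w.val / 2 : ℕ) : ZMod L)).val = w.val / 2 := fun w hw ↦ by
    rw [ZMod.val_natCast, Nat.mod_eq_of_lt (Nat.div_lt_of_lt_mul (by rw [mul_comm, ← hmL]; exact ZMod.val_lt w))]
  have hℓw : ∀ w ∈ s, liftBy m L 2 (((w.val / 2 : ℕ) : ZMod L)) = w := fun w hw ↦ by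
    rw [liftBy, hdiv w hw, Nat.div_mul_cancel (heven w hw), ZMod.natCast_zmod_val]
  have hss' : s'.map (liftBy m L 2) = s := by
    rw [hs', Multiset.map_map]
    conv_rhs => rw [← Multiset.map_id s]
    exact Multiset.map_congr rfl fun w hw ↦ hℓw w hw
  -- `s′` is a pair-free Hodge quadruple with a member prime to `3`, hence primitive
  have hs'H : IsHodgeMultiset s' := (isHodgeMultiset_map_liftBy_iff hmL two_pos s').mp (by rw [hss']; exact hs)
  have hs'card : card s' = 4 := by rw [hs', Multiset.card_map, hcard]
  have hs'pf : ¬ HasPair s' := by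
    rintro ⟨a, ha, hna⟩
    apply hpf
    refine ⟨liftBy m L 2 a, by rw [← hss']; exact Multiset.mem_map_of_mem _ ha, ?_⟩
    rw [← hss', ← Multiset.map_erase _ (liftBy_injective₈ hmL), ← liftBy_neg₈ hmL]
    exact Multiset.mem_map_of_mem _ hna
  obtain ⟨a, ha, ha3⟩ := hthree
  have ha' : (((a.val / 2 : ℕ) : ZMod L)) ∈ s' := by rw [hs']; exact Multiset.mem_map_of_mem _ ha
  have hcop : Nat.Coprime (((a.val / 2 : ℕ) : ZMod L)).val L := by
    rw [hdiv a ha, hL]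
    refine Nat.Coprime.pow_right _ ((Nat.Prime.coprime_iff_not_dvd Nat.prime_three).mpr fun h ↦ ha3 ?_).symm
    rw [← Nat.div_mul_cancel (heven a ha)]
    exact Dvd.dvd.mul_right h 2
  have hprim : IsPrimitive L s' := isPrimitive_of_coprime_mem ha' hcop
  have hstd : IsStandardQuadruple L s' := by
    by_contra hns
    exact not_isExceptionalQuadruple_three_pow (k := k + 1) (by omega) s' ⟨hs'card, hs'H, hs'pf, hprim, hns⟩
  -- read it back at level `m`: the level `L` is odd, so `s′ = γ_{x′}`
  have eL3 : L / 3 = 3 ^ k := by rw [hL, pow_succ, Nat.mul_div_cancel _ three_pos]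
  have em3 : m / 3 = 3 ^ k * 2 := by
    rw [hmL, hL, pow_succ, show 3 ^ k * 3 * 2 = 3 * (3 ^ k * 2) by ring, Nat.mul_div_cancel_left _ three_pos]
  have hR : liftBy m L 2 (((L / 3 : ℕ)) : ZMod L) = ((m / 3 : ℕ) : ZMod m) := by
    rw [liftBy, ZMod.val_natCast, Nat.mod_eq_of_lt (Nat.div_lt_self (NeZero.pos L) (by norm_num)), eL3, em3]
  obtain ⟨x', ⟨h2L, -⟩ | ⟨-, hγ⟩⟩ := isStdMultiset_of_isStandardQuadruple hstd
  · exfalso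
    rw [hL] at h2L
    have := Nat.Prime.dvd_of_dvd_pow Nat.prime_two h2L
    omega
  · refine ⟨liftBy m L 2 x', Or.inr ⟨h3m, ?_⟩⟩
    rw [← hss', hγ]
    simp only [Multiset.insert_eq_cons, Multiset.map_cons, Multiset.map_singleton, liftBy_add₈ hmL, liftBy_neg₈ hmL, hR,
      (liftBy_mul₈ hmL _).1, (liftBy_mul₈ hmL _).2]

/-! ### The inductive step, the induction, `Δ(2·3ᵇ) = 0` -/

/-- **The step `T(2·3ᵇ⁻¹) ⟹ T(2·3ᵇ)`** (`b ≥ 4`): a pair-free Hodge `4`-multiset over `ℤ/2·3ᵇ` is standard or a lift from a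
level `≤ 72` — all members divisible by `3`: division by `3` (part II) and `T(2·3ᵇ⁻¹)`; a unit member: part VII; otherwise a
member prime to `3` is even, all members are even (part VII, `even_of_noUnit_twiceThreePow`) and `s = γ_{2x′}`.
[cite: Aoki1983, Thm. C p. 47] [cite: Shioda1982PicardFermat, Prop. 4 (Q′) p. 729] [cite: AokiShioda1983, Thm. (𝔅²ₘ) (ii)] -/
theorem std_or_small_twiceThreePow (hm : m = 6 * n) (hn : n = 3 ^ k) (hk : 3 ≤ k) (IH₃ : StdOrSmall (2 * n))
    {s : Multiset (ZMod m)} (hs : IsHodgeMultiset s) (hcard : card s = 4) (hpf : ¬ HasPair s) :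
    IsStdMultiset m s ∨ IsSmallLift m s := by
  haveI : NeZero (2 * n) := ⟨by have := n_pos₈ hn; omega⟩
  have h2N : 2 ∣ 2 * n := Dvd.intro n rfl
  have h3N : 3 ∣ 2 * n := Dvd.dvd.mul_left (three_dvd_n₈ hn (by omega)) 2
  by_cases hthree : ∀ a ∈ s, 3 ∣ a.val
  · exact std_or_small_of_all_three (N := 2 * n) (by rw [hm]; ring) h2N h3N IH₃ hs hcard hpf hthree
  push Not at hthree
  by_cases hunit : ∃ y ∈ s, ¬ 2 ∣ y.val ∧ ¬ 3 ∣ y.val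
  · obtain ⟨y, hy, hy2, hy3⟩ := hunit
    exact Or.inl (isStandardQuadruple_of_unit_mem_twiceThreePow hm hn hk hs hcard hpf hy hy2 hy3).2
  push Not at hunit
  have hnu : ∀ a ∈ s, 2 ∣ a.val ∨ 3 ∣ a.val := fun a ha ↦ by
    by_cases h : 2 ∣ a.val
    · exact Or.inl h
    · exact Or.inr (hunit a ha h)
  obtain ⟨e, he, he3⟩ := hthree
  have he2 : 2 ∣ e.val := (hnu e he).resolve_right he3
  have heven := even_of_noUnit_twiceThreePow hm hn (by omega) hs hcard hpf hnu he he2 he3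
  exact Or.inl (isStdMultiset_of_forall_even_twiceThreePow hm hn hs hcard hpf heven ⟨e, he, he3⟩)

/-- **`T(2·3ᵇ)` for every `b ≥ 2`** — the hypothesis `H₁` of `thmB2m_standard_twoThreePower` (`StandardQuadrupleTwoThreePower`): every pair-free Hodge
`4`-multiset over `ℤ/2·3ᵇ` is `α_x`, `β_x`, `γ_x` or a lift from a level `≤ 72`. Induction on `b`: `T(18)`, `T(54)` are void and
`std_or_small_twiceThreePow` is the step (`b ≥ 4`, `m ≥ 162`). [cite: Aoki1983, Thm. C p. 47]
[cite: Shioda1982PicardFermat, Prop. 4 (Q′) p. 729] [cite: AokiShioda1983, Thm. (𝔅²ₘ) (ii)] -/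
theorem stdOrSmall_twiceThreePow {b : ℕ} (hb : 2 ≤ b) : StdOrSmall (2 * 3 ^ b) := by
  induction b using Nat.strong_induction_on with
  | _ b IH =>
    by_cases h3 : b ≤ 3
    · apply stdOrSmall_of_le
      interval_cases b <;> norm_num
    obtain ⟨b', rfl⟩ : ∃ b', b = b' + 1 := ⟨b - 1, by omega⟩
    have hb' : 3 ≤ b' := by omega
    haveI : NeZero (2 * 3 ^ (b' + 1)) := ⟨by positivity⟩
    have IH₃ : StdOrSmall (2 * 3 ^ b') := IH b' (by omega) (by omega)
    intro t ht hc hp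
    exact std_or_small_twiceThreePow (m := 2 * 3 ^ (b' + 1)) (n := 3 ^ b') (k := b') (by rw [pow_succ]; ring) rfl hb' IH₃
      ht hc hp

/-- **`Δ(2·3ᵇ) = 0` for `b ≥ 4`, unconditionally**: no exceptional Hodge quadruple at the levels `m = 2·3ᵇ ≥ 162` — a primitive
pair-free Hodge quadruple is not inside `3ℤ/m` or `2ℤ/m`, so (part VII, `even_of_noUnit_twiceThreePow`) it has a unit member,
and is a standard quadruple (`isStandardQuadruple_of_unit_mem_twiceThreePow`). [Shioda1982PicardFermat, Prop. 4 (Q′)] =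
[Aoki1983, Thm. C] at these levels. [cite: Shioda1982PicardFermat, Prop. 4 (Q′) p. 729, table p. 727] [cite: Aoki1983, Thm. C p. 47]
[cite: MeyerNeutsch1981Fermatquadrupel, p. 53] -/
theorem not_isExceptionalQuadruple_twiceThreePow (hm : m = 6 * n) (hn : n = 3 ^ k) (hk : 3 ≤ k) (s : Multiset (ZMod m)) :
    ¬ IsExceptionalQuadruple m s := by
  rintro ⟨hcard, hs, hpf, hprim, hns⟩
  obtain ⟨h2m, h3m⟩ := two_three_dvd_m₈ hm
  by_cases hunit : ∃ y ∈ s, ¬ 2 ∣ y.val ∧ ¬ 3 ∣ y.val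
  · obtain ⟨y, hy, hy2, hy3⟩ := hunit
    exact hns (isStandardQuadruple_of_unit_mem_twiceThreePow hm hn hk hs hcard hpf hy hy2 hy3).1
  push Not at hunit
  have hnu : ∀ a ∈ s, 2 ∣ a.val ∨ 3 ∣ a.val := fun a ha ↦ by
    by_cases h : 2 ∣ a.val
    · exact Or.inl h
    · exact Or.inr (hunit a ha h)
  have hthree : ∃ a ∈ s, ¬ 3 ∣ a.val := by
    by_contra h
    push Not at h
    exact not_forall_dvd_of_isPrimitive₈ (by norm_num) h3m hprim h
  obtain ⟨e, he, he3⟩ := hthree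
  have he2 : 2 ∣ e.val := (hnu e he).resolve_right he3
  exact not_forall_dvd_of_isPrimitive₈ one_lt_two h2m hprim
    (even_of_noUnit_twiceThreePow hm hn (by omega) hs hcard hpf hnu he he2 he3)

end TwiceThreePowStd

/-! ### Assembly: all levels `2ᵃ3ᵇ` -/

section TwoThree

variable {m : ℕ} [NeZero m]

/-- **`T(2ᵃ3ᵇ)` for all `a, b ≥ 1`**: parts IV (`a, b ≥ 2`, from `H₁`, `H₂`), VI (`H₂ = T(2ᵃ·3)`), VIII (`H₁ = T(2·3ᵇ)`); `T(6)`
is void. [cite: Shioda1982PicardFermat, Prop. 4 (Q′) p. 729] [cite: AokiShioda1983, Thm. (𝔅²ₘ) (ii)] -/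
theorem stdOrSmall_twoThree {a b : ℕ} (ha : 1 ≤ a) (hb : 1 ≤ b) : StdOrSmall (2 ^ a * 3 ^ b) := by
  by_cases ha1 : a = 1
  · subst ha1
    by_cases hb1 : b = 1
    · subst hb1
      exact stdOrSmall_of_le (by norm_num)
    · rw [pow_one]
      exact stdOrSmall_twiceThreePow (by omega)
  by_cases hb1 : b = 1
  · subst hb1
    rw [pow_one]
    exact stdOrSmall_twoPowThree (by omega)
  exact stdOrSmall_twoThreePower (fun b hb ↦ stdOrSmall_twiceThreePow hb) (fun a ha ↦ stdOrSmall_twoPowThree ha)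
    (by omega) (by omega)

/-- **`Δ(m) = 0` for every `m = 2ᵃ3ᵇ > 72`: there is no exceptional Hodge quadruple at a `{2,3}`-smooth level above `72`** —
every indecomposable primitive Hodge quadruple is standard ([Shioda1982PicardFermat, Prop. 4 (Q′)] = [Aoki1983, Thm. C] at
these levels; `Δ(m) = 0` in the notation of Shioda's table p. 727, whose `{2,3}`-smooth rows above `72` — `96, 108, 144, 162` —
are `0`). Prime powers: [Shioda1982PicardFermat, Thm. 6 (b), (c)] (`not_isExceptionalQuadruple_two_pow`, `…_three_pow`);
`96`: the census (`ExceptionalQuadruplesCompleteLeOneHundredEighty`); `3·2ᵃ, a ≥ 6` and `2·3ᵇ, b ≥ 4`: above; `a, b ≥ 2`: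
`not_isExceptionalQuadruple_twoThreePower` with `H₁`, `H₂` discharged. [cite: Shioda1982PicardFermat, Prop. 4 (Q′) p. 729, Thm. 6 (b), (c) p. 731, table p. 727]
[cite: Aoki1983, Thm. C p. 47] [cite: MeyerNeutsch1981Fermatquadrupel, §2 p. 53, Tabelle 1 p. 54] -/
theorem not_isExceptionalQuadruple_twoThree {a b : ℕ} (hm : m = 2 ^ a * 3 ^ b) (h72 : 72 < m) (s : Multiset (ZMod m)) :
    ¬ IsExceptionalQuadruple m s := by
  by_cases hb0 : b = 0
  · subst hb0
    have hm' : m = 2 ^ a := by rw [hm, pow_zero, mul_one]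
    subst hm'
    exact not_isExceptionalQuadruple_two_pow (Nat.pos_of_ne_zero (by rintro rfl; norm_num at h72)) s
  by_cases ha0 : a = 0
  · subst ha0
    have hm' : m = 3 ^ b := by rw [hm, pow_zero, one_mul]
    subst hm'
    exact not_isExceptionalQuadruple_three_pow (Nat.pos_of_ne_zero hb0) s
  by_cases ha1 : a = 1
  · -- `m = 2·3ᵇ`, `b ≥ 4`
    subst ha1
    have hb4 : 4 ≤ b := by
      by_contra h
      have : 3 ^ b ≤ 3 ^ 3 := Nat.pow_le_pow_right (by norm_num) (by omega)
      rw [hm] at h72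
      norm_num at this h72
      omega
    obtain ⟨k, rfl⟩ : ∃ k, b = k + 1 := ⟨b - 1, by omega⟩
    exact not_isExceptionalQuadruple_twiceThreePow (n := 3 ^ k) (k := k) (by rw [hm, pow_succ]; ring) rfl (by omega) s
  by_cases hb1 : b = 1
  · -- `m = 3·2ᵃ`, `a ≥ 5`
    subst hb1
    have ha5 : 5 ≤ a := by
      by_contra h
      have : 2 ^ a ≤ 2 ^ 4 := Nat.pow_le_pow_right (by norm_num) (by omega)
      rw [hm] at h72
      norm_num at this h72
      omega
    by_cases ha5' : a = 5
    · subst ha5'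
      have hm' : m = 96 := by rw [hm]; norm_num
      subst hm'
      exact not_isExceptionalQuadruple_of_le_oneHundredEighty 96 (by norm_num) (by norm_num) (by decide) s
    obtain ⟨i, rfl⟩ : ∃ i, a = i + 1 := ⟨a - 1, by omega⟩
    exact not_isExceptionalQuadruple_twoPowThree (n := 2 ^ i) (i := i) (by rw [hm, pow_succ]; ring) rfl (by omega) s
  exact not_isExceptionalQuadruple_twoThreePower (fun b hb ↦ stdOrSmall_twiceThreePow hb)
    (fun a ha ↦ stdOrSmall_twoPowThree ha) hm (by omega) (by omega) h72 s

/-- **The letter of [AokiShioda1983, Thm. (𝔅²ₘ) (ii)] = [Aoki1983, Thm. C] at every level `m = 2ᵃ3ᵇ > 72`, unconditionally**: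
every indecomposable (`aᵢ + aⱼ ≠ 0`) Hodge character of length `4` with coprime representatives is, up to a permutation, one
of the printed standard elements `αᵢ`, `βᵢ`, `γⱼ` — the body of the named fact `HodgeTheory.AokiShioda1983_thmB2m_standard` at
the `{2,3}`-smooth levels (`letter_of_forall_not_isExceptionalQuadruple` and `not_isExceptionalQuadruple_twoThree`).
[cite: AokiShioda1983, §2 Thm. (𝔅²ₘ) (ii) a), b), c), p. 3] [cite: Aoki1983, Thm. C p. 47] -/
theorem thmB2m_standard_twoThree {a b : ℕ} (hm : m = 2 ^ a * 3 ^ b) (h72 : 72 < m) (α : Fin 4 → ZMod m) (hα : IsHodge α)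
    (hind : ∀ i j : Fin 4, i ≠ j → α i + α j ≠ 0) (hprim : ∀ g : ℕ, (∀ i, g ∣ (α i).val) → g = 1) :
    ∃ σ : Equiv.Perm (Fin 4),
      (∃ d i : ℕ, m = 2 * d ∧ 1 ≤ i ∧ i < d ∧ Nat.Coprime i d ∧ 4 * i ≠ m ∧
          ∀ k, α (σ k) = ![(i : ZMod m), (d : ZMod m) + i, -(2 * (i : ZMod m)), (d : ZMod m)] k) ∨
      (∃ d i : ℕ, m = 2 * d ∧ 1 ≤ i ∧ i < d ∧ Nat.Coprime i d ∧ 3 * i ≠ m ∧ 4 * i ≠ m ∧ 6 * i ≠ m ∧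
          ∀ k, α (σ k) =
            ![(i : ZMod m), (d : ZMod m) + i, (d : ZMod m) + 2 * i, -(4 * (i : ZMod m))] k) ∨
      (∃ d j : ℕ, m = 3 * d ∧ 1 ≤ j ∧ j < d ∧ Nat.Coprime j d ∧ 6 * j ≠ m ∧
          ∀ k, α (σ k) =
            ![(j : ZMod m), (d : ZMod m) + j, 2 * (d : ZMod m) + j, -(3 * (j : ZMod m))] k) :=
  letter_of_forall_not_isExceptionalQuadruple (not_isExceptionalQuadruple_twoThree hm h72) α hα hind hprim

/-- A positive number whose prime factors are among `2, 3` is `2ᵃ3ᵇ`. [folklore] -/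
private theorem eq_two_pow_mul_three_pow {m : ℕ} (hm0 : m ≠ 0) (h : ∀ p : ℕ, p.Prime → p ∣ m → p = 2 ∨ p = 3) :
    m = 2 ^ m.factorization 2 * 3 ^ m.factorization 3 := by
  have key := Nat.prod_factorization_pow_eq_self hm0
  rw [Finsupp.prod, Nat.support_factorization] at key
  have hsub : m.primeFactors ⊆ {2, 3} := fun p hp ↦ by
    rcases h p (Nat.prime_of_mem_primeFactors hp) (Nat.dvd_of_mem_primeFactors hp) with rfl | rfl <;> simp
  rw [Finset.prod_subset hsub (fun p _ hpn ↦ by rw [Finsupp.notMem_support_iff.mp (by rwa [Nat.support_factorization]),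
    pow_zero])] at key
  rw [Finset.prod_pair (by norm_num : (2 : ℕ) ≠ 3)] at key
  exact key.symm

/-- **The named fact `AokiShioda1983_thmB2m_standard` reduces to the levels `2ᵃ3ᵇ·5`, `2ᵃ3ᵇ·7`, `2ᵃ3ᵇ·35` above `630`.**
If the letter of [AokiShioda1983, Thm. (𝔅²ₘ) (ii)] holds at every level `m > 630` with all prime factors `≤ 7`, `25 ∤ m`,
`49 ∤ m` and `5 ∣ m` or `7 ∣ m`, then it holds at every level `m > 180` with `(m, 6) > 1`: the `{2,3}`-smooth levels are
`thmB2m_standard_twoThree`, the rest is `AokiShioda1983_thmB2m_standard_of_towers` (`ExceptionalQuadruplesNoneUpTo630`: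
`m < 631` by the kernel sweeps, good primes, prime powers). A proved REDUCTION, not a discharge: the residual hypothesis is the
part of [Aoki1983, Thm. C] at the levels `2ᵃ3ᵇ5`, `2ᵃ3ᵇ7`, `2ᵃ3ᵇ35 > 630`, resting on Aoki's Thm. D (structure of `𝔅¹ₘ`),
which the tree does not have. [cite: AokiShioda1983, §2 Thm. (𝔅²ₘ) (ii), p. 3] [cite: Aoki1983, Thm. C, p. 47] -/
theorem AokiShioda1983_thmB2m_standard_of_fiveSeven
    (h57 : ∀ (m : ℕ) [NeZero m], 630 < m → (∀ p : ℕ, p.Prime → p ∣ m → p ≤ 7) → ¬ 25 ∣ m → ¬ 49 ∣ m →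
      (5 ∣ m ∨ 7 ∣ m) →
      ∀ α : Fin 4 → ZMod m, IsHodge α →
        (∀ i j : Fin 4, i ≠ j → α i + α j ≠ 0) →
        (∀ g : ℕ, (∀ i, g ∣ (α i).val) → g = 1) →
    ∃ σ : Equiv.Perm (Fin 4),
      (∃ d i : ℕ, m = 2 * d ∧ 1 ≤ i ∧ i < d ∧ Nat.Coprime i d ∧ 4 * i ≠ m ∧
          ∀ k, α (σ k) = ![(i : ZMod m), (d : ZMod m) + i, -(2 * (i : ZMod m)), (d : ZMod m)] k) ∨
      (∃ d i : ℕ, m = 2 * d ∧ 1 ≤ i ∧ i < d ∧ Nat.Coprime i d ∧ 3 * i ≠ m ∧ 4 * i ≠ m ∧ 6 * i ≠ m ∧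
          ∀ k, α (σ k) =
            ![(i : ZMod m), (d : ZMod m) + i, (d : ZMod m) + 2 * i, -(4 * (i : ZMod m))] k) ∨
      (∃ d j : ℕ, m = 3 * d ∧ 1 ≤ j ∧ j < d ∧ Nat.Coprime j d ∧ 6 * j ≠ m ∧
          ∀ k, α (σ k) =
            ![(j : ZMod m), (d : ZMod m) + j, 2 * (d : ZMod m) + j, -(3 * (j : ZMod m))] k)) :
    AokiShioda1983_thmB2m_standard :=
  AokiShioda1983_thmB2m_standard_of_towers fun m _ _ h630 hsm h25 h49 _ _ α hα hind hprim ↦ by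
    by_cases h57m : 5 ∣ m ∨ 7 ∣ m
    · exact h57 m h630 hsm h25 h49 h57m α hα hind hprim
    · push Not at h57m
      have h23 : ∀ p : ℕ, p.Prime → p ∣ m → p = 2 ∨ p = 3 := fun p hp hpm ↦ by
        have h7 := hsm p hp hpm
        have h2 := hp.two_le
        interval_cases p
        · exact Or.inl rfl
        · exact Or.inr rfl
        · exact absurd hp (by norm_num)
        · exact absurd hpm h57m.1
        · exact absurd hp (by norm_num)
        · exact absurd hpm h57m.2
      exact thmB2m_standard_twoThree (eq_two_pow_mul_three_pow (by omega) h23) (by omega) α hα hind hprim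

end TwoThree

end Literature.AlgebraicGeometry.Shioda1982
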